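import Literature.AlgebraicGeometry.HodgeTheory.WeilTypeBlockedHodgeGroupOfLie
import Literature.AlgebraicGeometry.HodgeTheory.WeilTypeTiedAdaptedDualBases
import Literature.AlgebraicGeometry.HodgeTheory.HodgeEndomorphismsHOneOfRiemann
import Literature.AlgebraicGeometry.HodgeTheory.RankOneCentreTimesCMCurveInvariance
import Literature.AlgebraicGeometry.ComplexMultiplication.ShimuraInflationBettiJunctions
import Literature.RepresentationTheory.ClassicalInvariants.MixedTensorLieInvariantsSLBlockDiagonalTied
import HarnessLib

/-!
# The Lie-to-group passage for abelian varieties of Weil type whose endomorphisms act on the Weil space `W_K` BLOCK-SCALARLY WITH TIED RANK-ONE BLOCKS (`Y₄ × E_K²`, `End⁰ ⊇ K × M₂(K)`): «`Lie Hg(H¹A) ⊗ ℂ ∋` every `End(A)`-commuting `ψ`-skew `W_K`-traceless operator» ⟹ «`Hg(A)(ℂ)|_{H¹} ⊇ S(A)(ℂ) ∩ {det_{W_K} = 1}`» (the socket «R20-S» of TABLE X row 20)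

Family `hodge`, layer `Literature/AlgebraicGeometry/HodgeTheory`, namespace `Literature.AlgebraicGeometry.HodgeTheory`.
THEOREMS ONLY: no definition, no named fact, no `sorry` (D-0026). Cell `pub-hodgeav-hg6` (req-37 (A) Q2b), seat eng-2 g8,
brick **R20-S** part S3-T (lead g4 2026-08-29T08:45:11Z GO; parts S1-T = `ClassicalInvariants/MixedTensorLieInvariantsSLBlockDiagonalTied`,
S2-T = `HodgeTheory/WeilTypeTiedAdaptedDualBases`). HONEST FRAMING: HC ∕ HC_AV (stmt-1333) ∕ HC_CM (stmt-3052) ∕ H2 NOT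
proved; the Lie hypothesis `hSU` («every operator commuting with ALL pull-backs `θ^*_ℂ`, `θ ∈ End(A)`, `ψ_ℂ`-skew and with
trace `0` on `W_K = ker(φ_ℂ − i√d)` lies in `Lie Hg(H¹A) ⊗ ℂ`» — the row's Lie theorem, the AV reading of the cell's product brick)
is DISPLAYED on every theorem, never discharged here.

## The statement and its place

The census file of TABLE X row 20 (`SixfoldTableXCensusWeilSquareProductRowDomain`, L18b:
`TableX.WeilERows.census_weilType_detOne_general_prod_prod`) displays the GROUP-LEVEL hypothesis
`hG : ∀ u ∈ S(A)(h)(ℂ) = unitaryCentralizerGroup A h, det(u | W_K) = 1 → u ∈ Hg(A)(ℂ)|_{H¹}`. The tree's sockets deriving `hG`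
from a Lie statement — B5a (`End⁰ = K`), B5a-E (CM field `E ⊋ K`), B5a-P = S3 `WeilTypeBlockedHodgeGroupOfLie` (`End⁰ = ℚ[φ_E]`
commutative, `finrank End⁰ = 2|ι|`) — all require a COMMUTATIVE endomorphism algebra, which row 20 (`A ∼ Y₄ × E_K²`,
`End⁰(A) ⊇ K × M₂(K)`) does not have: on `W_K = W_Y ⊕ W_{E,1} ⊕ W_{E,2}` the two `E`-lines are exchanged by `M₂(K)`, every
element of `S(A)(ℂ)` is `diag(M_Y, λ, λ)` and the Hodge Lie algebra is `{diag(X_Y, a, a) : tr X_Y + 2a = 0}` — TIED rank-one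
blocks. This file is S3 with (a) the blocking endomorphism `φ_E` NOT assumed to generate `End⁰` (instead: `End(A)` acts on each
UNTIED colour block `W_{μ k}`, `k ∉ S`, by scalars — `hEndU` — and preserves the span of the TIED rank-one colour blocks
`W_{μ k}`, `k ∈ S` — `hEndT`; the tied blocks are linked by endomorphisms — `hσ`), (b) the diagonal `K = ℚ(φ)` CENTRAL (`hφC`),
(c) the Lie hypothesis in the ALL-ENDOMORPHISMS form, and (d) `v ∈ C(A)^×` obtained not from `End_Hdg = ℚ[φ_E^*]` but from
`u ∈ C(A)` by the adjoint trick (`ψ_ℂ(x, v θ^* y) = ψ_ℂ(x, θ^* v y)` tested against `W_K`, which `ψ_ℂ`-separates `W̄_K`):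
* §0 `exists_eq_smul_bettiMapHom_of_mem_endAlg` (Riemann: every Hodge endomorphism of `H¹` is `c · F^*`),
  `eq_sum_form_smul_of_mem_eigenspace` (dual expansion in `W̄_K`).
* §1 **`AVSlots.exists_tiedBlockSlInvariant_coeff_of_hodgeLieC`** — under `hSU`, the coefficient functions (in the letters
  of S2-T) of the rational `(p,p)`-classes on varieties with slots over `A` are killed by the typed differential of every
  block-diagonal traceless `X` TIED on the tied letters (the operator `X ⊕ −Xᵀ` commutes with every Hodge endomorphism:
  on `W_K` letter by letter, on `W̄_K` by the adjoint trick with `η† ∈ End_Hdg`).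
* §2 **`IsWeilType.mem_hodgeGroupOne_of_mem_unitaryCentralizerGroup_tied_of_hodgeLieC`** — THE SOCKET: for
  `u ∈ S(A)(h)(ℂ)` with `det(u | W_K) = 1`, `u ∈ Hg(A)(ℂ)|_{H¹}` (`M` = matrix of `u|_{W_K}` is block-diagonal, tied, `det 1`;
  `v = (M, (M⁻¹)ᵀ)` on the letters commutes with `φ_ℂ`, with every `θ^*_ℂ`, preserves `ψ_ℂ`; the slices of every Hodge
  class of every power are fixed by `M` (S1-T `wordRepAt_mixedGrpFamily_eq_self_of_forall_tiedBlockDiag_trace_of_det_eq_one`),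
  so `v ∈ Hg|_{H¹} ≤ S(A)(h)` (B5a §2) and `u = v` by `Q_h`-isotropy of `W̄_K` — S3 §3 verbatim).
AV-level data (all dischargeable for `A ∼ Y₄ × E_K²` from the product structure): `(A, φ)` of Weil type `(n, d)`, `φ`
central in `End(A)`; `φ_E ∈ End(A)` with colours `μ : ι → ℂ` (injective), eigenspaces `W_{μ k} ≠ ⊥` with
`W_{μ k} ≤ W_K ≤ ⨆_k W_{μ k}`; a set `S` of tied colours (`finrank W_{μ k} = 1` for `k ∈ S`, some colour untied), ties `hσ`,
and the shape hypotheses `hEndU`, `hEndT`. NO commutativity of `End⁰(A)`.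

IN PRINT? Method: Deligne I §3, Goodman–Wallach Thm. 2.2.7 (2), Gordon §6, Moonen–Zarhin (5.11); the statement as a socket
for `Y × E_K²` is not in print (presearch of the R20-S design: null) — RECORD-class.

## References
* [Deligne1982HodgeCycles] P. Deligne, LNM 900 (1982), I §3 Prop. 3.4, 3.6, §4 (p. 30).
* [MoonenZarhin1999LowDim] B. Moonen, Yu. Zarhin, Math. Ann. 315 (1999), §1 (1.8), §2 (2.3), §5 (5.11).
* [GoodmanWallachGTM255] R. Goodman, N. R. Wallach, GTM 255 (2009), Lemma 2.2.1, Thm. 2.2.2, Thm. 2.2.7 (2), §4.1.1.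
* [Milne1999LefschetzClasses] J. S. Milne, Duke Math. J. 96 (1999), §1 pp. 643–644, §4 p. 659.
* [Gordon1997] B. B. Gordon, arXiv:alg-geom/9709030, §6 pp. 18–19.
* [vanGeemen1994HodgeAV] B. van Geemen, LNM 1594 (1994), 6.9, Lemma 6.10.
* [DeligneMilne1982Tannakian] P. Deligne, J. S. Milne, LNM 900 (1982), §6 Thm. 6.20 (Riemann: `End_Hdg(H¹) = End⁰(A)`).
-/

noncomputable section

open scoped TensorProduct
open scoped Matrix
open CategoryTheory Module

namespace Literature.AlgebraicGeometry.HodgeTheory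

open Literature.AlgebraicTopology.SingularHomology
open Literature.AlgebraicGeometry.Motives (IsSmoothProjective AbelianVariety bettiCohomology
  ofRatClassBaseChange ofRatClassBaseChange_tmul HodgeTensorFacts hodgeTensorFacts_holds)
open Literature.AlgebraicGeometry.Motives.HodgeStructure
open Literature.RepresentationTheory.GeneralLinear
open Literature.RepresentationTheory.ClassicalInvariants
open Literature.NumberTheory.DiophantineGeometry
open Literature.AlgebraicGeometry.VanGeemen1994 (pullbackOne hodgeGroupOne mem_hodgeGroupOne_iff hodgeClassSpan
  detOnEigenspace)
open Literature.AlgebraicGeometry.Milne1999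
open Literature.AlgebraicGeometry.ComplexMultiplication (bettiRep bettiRep_of bettiCohomology_map_comp_hom)

/-! ### §0 Riemann's theorem in the form used here, and the dual expansion in `W̄_K` -/

section Prelim

variable {A : AbelianVariety ℂ}

/-- The two elements of `Fin 2`. [folklore] -/
private theorem fin2_cases₇ (r : Fin 2) : r = 0 ∨ r = 1 := by
  fin_cases r <;> simp

/-- **Riemann: every Hodge endomorphism of `H¹(A(ℂ); ℚ)` is a rational multiple of a pull-back `F^*`, `F ∈ End(A)`**
(the tree's `mem_endAlg_hodge_one_iff_exists_bettiRep` + `exists_unop_bettiRep_eq_smul_pull`).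
[cite: DeligneMilne1982Tannakian, §6 Thm. 6.20] -/
theorem exists_eq_smul_bettiMapHom_of_mem_endAlg {η : Module.End ℚ (bettiCohomology A.X 1)}
    (hη : η ∈ (BettiUniverse.hodge exists_isReal_hodgeModel_holds (AbelianVariety.isSmoothProjective_holds (A := A)) 1).endAlg) :
    ∃ (c : ℚ) (F : A ⟶ A), η = c • (bettiCohomology.map F.hom.hom.hom 1).hom := by
  obtain ⟨e, he⟩ := (mem_endAlg_hodge_one_iff_exists_bettiRep exists_isReal_hodgeModel_holds
    hodgePQ_independent_of_hodgeModel_holds η).1 hη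
  obtain ⟨c, F, hF⟩ := exists_unop_bettiRep_eq_smul_pull e
  exact ⟨c, F, by rw [← he, hF]⟩

/-- `(θ ≫ φ = φ ≫ θ) ⟹ θ^* ∘ φ^* = φ^* ∘ θ^*` on `H¹(A(ℂ); ℚ)`. [cite: Deligne1982HodgeCycles, §4 p. 30] -/
theorem bettiMapHom_comm_of_comm {θ φ : A ⟶ A} (h : θ ≫ φ = φ ≫ θ) :
    (bettiCohomology.map θ.hom.hom.hom 1).hom * (bettiCohomology.map φ.hom.hom.hom 1).hom =
      (bettiCohomology.map φ.hom.hom.hom 1).hom * (bettiCohomology.map θ.hom.hom.hom 1).hom := by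
  have h1 : (bettiCohomology.map (θ ≫ φ).hom.hom.hom 1).hom = (bettiCohomology.map (φ ≫ θ).hom.hom.hom 1).hom := by
    rw [h]
  rw [bettiCohomology_map_comp_hom, bettiCohomology_map_comp_hom, ModuleCat.hom_comp, ModuleCat.hom_comp] at h1
  exact h1

variable {V : Type*} [AddCommGroup V] [Module ℂ V] {n₀ : ℕ}

/-- **Dual expansion in `W̄_K`**: for adapted dual letters (`cb (0,ℓ) ∈ W_K = ker(f − μK)`, `cb (1,ℓ) ∈ W̄_K = ker(f − μK')`,
`μK' ≠ μK`, pairing table `B(cb (0,i), cb (1,j)) = δ_{ij}`), every `y ∈ W̄_K` is `Σ_i B(cb (0,i), y) · cb (1,i)`.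
[cite: vanGeemen1994HodgeAV, 6.9] -/
theorem eq_sum_form_smul_of_mem_eigenspace (cb : Module.Basis (Fin 2 × Fin n₀) ℂ V) {f : Module.End ℂ V} {μK μK' : ℂ}
    (hne : μK' ≠ μK) (hKcb : ∀ ℓ, cb (0, ℓ) ∈ Module.End.eigenspace f μK)
    (hKcb' : ∀ ℓ, cb (1, ℓ) ∈ Module.End.eigenspace f μK') (B : LinearMap.BilinForm ℂ V)
    (hdual : ∀ i j, B (cb (0, i)) (cb (1, j)) = if i = j then 1 else 0) {y : V}
    (hy : y ∈ Module.End.eigenspace f μK') : y = ∑ i, B (cb (0, i)) y • cb (1, i) := by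
  classical
  -- expand `y` on `cb` and split by type
  have hrepr := cb.sum_repr y
  rw [Fintype.sum_prod_type, Fin.sum_univ_two] at hrepr
  set y0 := ∑ ℓ, cb.repr y (0, ℓ) • cb (0, ℓ) with hy0def
  set y1 := ∑ ℓ, cb.repr y (1, ℓ) • cb (1, ℓ) with hy1def
  have hy0K : y0 ∈ Module.End.eigenspace f μK := Submodule.sum_mem _ fun ℓ _ => Submodule.smul_mem _ _ (hKcb ℓ)
  have hy1K' : y1 ∈ Module.End.eigenspace f μK' := Submodule.sum_mem _ fun ℓ _ => Submodule.smul_mem _ _ (hKcb' ℓ)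
  have hy0K' : y0 ∈ Module.End.eigenspace f μK' := by
    have h : y0 = y - y1 := by rw [← hrepr, add_sub_cancel_right]
    rw [h]
    exact Submodule.sub_mem _ hy hy1K'
  have hy00 : y0 = 0 := by
    rw [Module.End.mem_eigenspace_iff] at hy0K hy0K'
    have h : (μK - μK') • y0 = 0 := by rw [sub_smul, ← hy0K, ← hy0K', sub_self]
    exact (smul_eq_zero.1 h).resolve_left (sub_ne_zero.2 (Ne.symm hne))
  have hy_eq : y = y1 := by rw [← hrepr, hy00, zero_add]
  -- the coefficients are the pairings with the type-`0` letters
  have hcoef : ∀ i, B (cb (0, i)) y1 = cb.repr y (1, i) := fun i => by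
    rw [hy1def, map_sum]
    simp only [map_smul, smul_eq_mul, hdual, mul_ite, mul_one, mul_zero, Finset.sum_ite_eq, Finset.mem_univ, if_true]
  calc y = y1 := hy_eq
    _ = ∑ i, cb.repr y (1, i) • cb (1, i) := hy1def
    _ = ∑ i, B (cb (0, i)) y • cb (1, i) := Finset.sum_congr rfl fun i _ => by rw [← hcoef i, hy_eq]

end Prelim

/-! ### §1 INVARIANCE: under «`Lie Hg ⊗ ℂ ∋` every `End(A)`-commuting `ψ`-skew `W_K`-traceless operator» the Hodge classes on varieties with slots over `A` are killed by the TIED block-diagonal traceless typed differentials -/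

section Invariance

variable {A B : AbelianVariety ℂ} {n : ℕ} {g : Fin n → (B ⟶ A)}

set_option maxHeartbeats 400000 in
open scoped Classical in
/-- **THE INVARIANCE THEOREM under the displayed Lie hypothesis `hSU` (tied blocked form).** Data: `A` a complex abelian
variety with `φ ∈ End(A)` whose pull-back `φ^*` is CENTRAL in `End_Hdg(H¹)` (`hZ`), `ψ` a polarization of `H¹(A(ℂ); ℚ)`,
`hSU`: every operator commuting with ALL pull-backs `θ^*_ℂ`, `ψ_ℂ`-skew and with trace `0` on `W_K = ker(φ^*_ℂ − μK)` lies
in `Lie Hg ⊗ ℂ`; adapted `ψ_ℂ`-dual letters `cb (t, ℓ)` (S2-T): type-`0` letters in `W_K`, type-`1` letters in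
`ker(φ^*_ℂ − μK')`, `μK' ≠ μK`, kinds `κ`, pairing table `δ`, same-type pairings `0`; a block map `blk` and a set `T` of TIED
letters, each a block by itself (`hT1`); and the letter shape of the Hodge endomorphisms: every `η ∈ End_Hdg(H¹)` acts on each
UNTIED type-`0` letter by a scalar depending only on its block (`hEU`) and maps each tied type-`0` letter into the span of the
tied type-`0` letters (`hET`). Then every rational `(p,p)`-class on a variety `B` with slots `g` over `A` (`p ≥ 1`) is
`∑_w a(w)·(g cb)_w` for a coefficient function `a` such that for every slot-and-type word `U` and every BLOCK-DIAGONAL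
TRACELESS `X` TIED on `T` (`X a a = X b b`, `a, b ∈ T`) the typed differential (`X` at type `0`, `−Xᵀ` at type `1`) kills the
slice `a(U, −)`: the operator `Y = X ⊕ −Xᵀ` commutes with `φ^*_ℂ`, is `ψ_ℂ`-skew, has `tr(Y|W_K) = tr X = 0`, and commutes
with EVERY Hodge endomorphism `η_ℂ` — on the type-`0` letters by `hEU` ∕ `hET`, on the type-`1` letters by the ADJOINT TRICK
`ψ_ℂ(cb (0,i), Y η y) = ψ_ℂ(cb (0,i), η Y y)` (`η† ∈ End_Hdg`, `Polarization.form_baseChange_adjoint_left`) and the dual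
expansion — hence with every `θ^*_ℂ`; so `hSU` puts it in `Lie Hg ⊗ ℂ` and Theorem L-Hg (`wordDerAt_eq_zero_of_mem_hodgeLieC`)
kills the rational coefficient tensor. Letter transport = the tree's B5a ∕ S3 §1 (credited).
[cite: Deligne1982HodgeCycles, I §3 Prop. 3.4 and §4 (p. 30)] [cite: MoonenZarhin1999LowDim, §1 (1.8), §2 (2.3) and §3 (3.1)]
[cite: Gordon1997, §6 (pp. 18–19)] -/
theorem AVSlots.exists_tiedBlockSlInvariant_coeff_of_hodgeLieC [HodgeTensorFacts.{0, 0}] (hg : AVSlots A B g)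
    (ψ : (BettiUniverse.hodge exists_isReal_hodgeModel_holds (AbelianVariety.isSmoothProjective_holds (A := A)) 1).Polarization)
    (φ : A ⟶ A)
    (hZ : ∀ η ∈ (BettiUniverse.hodge exists_isReal_hodgeModel_holds (AbelianVariety.isSmoothProjective_holds (A := A)) 1).endAlg,
      η * (bettiCohomology.map φ.hom.hom.hom 1).hom = (bettiCohomology.map φ.hom.hom.hom 1).hom * η)
    {μK μK' : ℂ} (hμK : μK' ≠ μK)
    (hSU : ∀ (Y : Module.End ℂ (ℂ ⊗[ℚ] bettiCohomology A.X 1))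
      (hall : ∀ θ : A ⟶ A, Y * ((bettiCohomology.map θ.hom.hom.hom 1).hom).baseChange ℂ =
        ((bettiCohomology.map θ.hom.hom.hom 1).hom).baseChange ℂ * Y),
      (∀ x y, ψ.form.baseChange ℂ (Y x) y + ψ.form.baseChange ℂ x (Y y) = 0) →
      LinearMap.trace ℂ _ (Y.restrict fun x (hx : x ∈ Module.End.eigenspace
          (((bettiCohomology.map φ.hom.hom.hom 1).hom).baseChange ℂ) μK) =>
        UnitaryTheta.apply_mem_eigenspace_of_commute (hall φ) hx) = 0 →
      Y ∈ (BettiUniverse.hodge exists_isReal_hodgeModel_holds (AbelianVariety.isSmoothProjective_holds (A := A)) 1).hodgeLieC)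
    {ι : Type} {n₀ : ℕ} (cb : Module.Basis (Fin 2 × Fin n₀) ℂ (ℂ ⊗[ℚ] bettiCohomology A.X 1))
    (κ : Fin n₀ → Fin 2) (blk : Fin n₀ → ι) (T : Finset (Fin n₀)) (hT1 : ∀ a ∈ T, ∀ b, blk b = blk a → b = a)
    (hKcb : ∀ ℓ, cb (0, ℓ) ∈ Module.End.eigenspace (((bettiCohomology.map φ.hom.hom.hom 1).hom).baseChange ℂ) μK)
    (hKcb' : ∀ ℓ, cb (1, ℓ) ∈ Module.End.eigenspace (((bettiCohomology.map φ.hom.hom.hom 1).hom).baseChange ℂ) μK')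
    (hcb0 : ∀ ℓ, κ ℓ = 0 →
      cb (0, ℓ) ∈ (BettiUniverse.hodge exists_isReal_hodgeModel_holds (AbelianVariety.isSmoothProjective_holds (A := A)) 1).piece 1 0 ∧
      cb (1, ℓ) ∈ (BettiUniverse.hodge exists_isReal_hodgeModel_holds (AbelianVariety.isSmoothProjective_holds (A := A)) 1).piece 0 1)
    (hcb1 : ∀ ℓ, κ ℓ = 1 →
      cb (0, ℓ) ∈ (BettiUniverse.hodge exists_isReal_hodgeModel_holds (AbelianVariety.isSmoothProjective_holds (A := A)) 1).piece 0 1 ∧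
      cb (1, ℓ) ∈ (BettiUniverse.hodge exists_isReal_hodgeModel_holds (AbelianVariety.isSmoothProjective_holds (A := A)) 1).piece 1 0)
    (hdual : ∀ i j, ψ.form.baseChange ℂ (cb (0, i)) (cb (1, j)) = if i = j then 1 else 0)
    (hiso : ∀ (t : Fin 2) i j, ψ.form.baseChange ℂ (cb (t, i)) (cb (t, j)) = 0)
    (hEU : ∀ η ∈ (BettiUniverse.hodge exists_isReal_hodgeModel_holds (AbelianVariety.isSmoothProjective_holds (A := A)) 1).endAlg,
      ∃ s : ι → ℂ, ∀ ℓ, ℓ ∉ T → η.baseChange ℂ (cb (0, ℓ)) = s (blk ℓ) • cb (0, ℓ))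
    (hET : ∀ η ∈ (BettiUniverse.hodge exists_isReal_hodgeModel_holds (AbelianVariety.isSmoothProjective_holds (A := A)) 1).endAlg,
      ∀ ℓ ∈ T, η.baseChange ℂ (cb (0, ℓ)) ∈ Submodule.span ℂ (Set.range fun ℓ' : {ℓ' // ℓ' ∈ T} => cb (0, ℓ'.1)))
    {p : ℕ} (hp : 0 < p) {c : complexBetti B.X (2 * p)} (hcQ : IsRationalClass c)
    (hc : IsOfHodgeType B.dim B.X (2 * p) p p c) :
    ∃ a : (Fin (2 * p) → (Fin n × Fin 2) × Fin n₀) → ℂ,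
      wordEval (cupPowOneAlt ℂ (Motives.ComplexPoints B.X) (2 * p))
        (fun x : (Fin n × Fin 2) × Fin n₀ => avLetters g (fun tl : Fin 2 × Fin n₀ =>
          ofRatClassBaseChange (Motives.ComplexPoints A.X) 1 (cb tl)) (x.1.1, (x.1.2, x.2))) a = c ∧
      ∀ (U : Fin (2 * p) → Fin n × Fin 2) (X : Matrix (Fin n₀) (Fin n₀) ℂ), (∀ i j, blk i ≠ blk j → X i j = 0) →
        X.trace = 0 → (∀ a ∈ T, ∀ b ∈ T, X a a = X b b) →
        wordDerAt ℂ (fun t => if (U t).2 = 0 then X else -Xᵀ) (wordSlice a U) = 0 := by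
  classical
  -- (the letter transport below is that of B5a `AVSlots.exists_slInvariant_coeff_of_hodgeLieC` ∕ S3 §1)
  -- the setting
  have hHD : exists_isReal_hodgeModel := exists_isReal_hodgeModel_holds
  have hI : hodgePQ_independent_of_hodgeModel := hodgePQ_independent_of_hodgeModel_holds
  have hX : IsSmoothProjective A.dim A.X := AbelianVariety.isSmoothProjective_holds
  haveI : Module.Finite ℚ (bettiCohomology A.X 1) := finite_bettiCohomology_one A
  have hn1 : (((1 : ℕ) : ℤ)) = 1 := Nat.cast_one
  have heff := BettiUniverse.hodge_isEffective hHD hX 1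
  set φK : Module.End ℚ (bettiCohomology A.X 1) := (bettiCohomology.map φ.hom.hom.hom 1).hom with hφKdef
  set F := cupPowOneAlt ℂ (Motives.ComplexPoints B.X) (2 * p) with hFdef
  have hFinj : Function.Injective (exteriorPower.alternatingMapLinearEquiv F) :=
    injective_alternatingMapLinearEquiv_cupPowOneAlt B (2 * p)
  -- bases: the adapted basis `cbσ` and the rational basis `eC`, both indexed by `Fin M`
  set eQ := Module.finBasis ℚ (bettiCohomology A.X 1) with heQ
  set eC : Module.Basis (Fin (Module.finrank ℚ (bettiCohomology A.X 1))) ℂ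
    (ℂ ⊗[ℚ] bettiCohomology A.X 1) := Algebra.TensorProduct.basis ℂ eQ with heC
  set φι : Fin (Module.finrank ℚ (bettiCohomology A.X 1)) ≃ Fin 2 × Fin n₀ := eC.indexEquiv cb with hφι
  set cbσ : Module.Basis (Fin (Module.finrank ℚ (bettiCohomology A.X 1))) ℂ
    (ℂ ⊗[ℚ] bettiCohomology A.X 1) := cb.reindex φι.symm with hcbσdef
  have hcbσ : ∀ m, cbσ m = cb (φι m) := fun m => by
    rw [hcbσdef, Module.Basis.reindex_apply, Equiv.symm_symm]
  -- kinds of the adapted letters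
  set κ2 : Fin 2 × Fin n₀ → Fin 2 := fun tl => if tl.1 = 0 then κ tl.2 else (if κ tl.2 = 0 then 1 else 0)
    with hκ2
  have hkind : ∀ tl : Fin 2 × Fin n₀,
      (κ2 tl = 0 → cb tl ∈ (BettiUniverse.hodge hHD (AbelianVariety.isSmoothProjective_holds (A := A)) 1).piece 1 0) ∧
      (κ2 tl = 1 → cb tl ∈ (BettiUniverse.hodge hHD (AbelianVariety.isSmoothProjective_holds (A := A)) 1).piece 0 1) := by
    rintro ⟨t, ℓ⟩
    rcases fin2_cases₇ t with rfl | rfl <;> rcases fin2_cases₇ (κ ℓ) with h | h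
    · have hk : κ2 (0, ℓ) = 0 := by simp [hκ2, h]
      rw [hk]
      exact ⟨fun _ => (hcb0 ℓ h).1, fun h' => absurd h' (by decide)⟩
    · have hk : κ2 (0, ℓ) = 1 := by simp [hκ2, h]
      rw [hk]
      exact ⟨fun h' => absurd h' (by decide), fun _ => (hcb1 ℓ h).1⟩
    · have hk : κ2 (1, ℓ) = 1 := by simp [hκ2, h]
      rw [hk]
      exact ⟨fun h' => absurd h' (by decide), fun _ => (hcb0 ℓ h).2⟩
    · have hk : κ2 (1, ℓ) = 0 := by simp [hκ2, h]
      rw [hk]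
      exact ⟨fun _ => (hcb1 ℓ h).2, fun h' => absurd h' (by decide)⟩
  set κ' : Fin (Module.finrank ℚ (bettiCohomology A.X 1)) → Fin 2 := fun m => κ2 (φι m) with hκ'
  -- letters
  set ρ := ofRatClassBaseChangeEquiv hX 1 with hρ
  set v : Module.Basis _ ℂ (complexBetti A.X 1) := cbσ.map ρ with hv
  set eL : Module.Basis _ ℂ (complexBetti A.X 1) := eC.map ρ with heL
  have heLQ : ∀ i, IsRationalClass (eL i) := fun i => by
    rw [heL, Module.Basis.map_apply, heC, Algebra.TensorProduct.basis_apply, hρ,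
      ofRatClassBaseChangeEquiv_apply, ofRatClassBaseChange_tmul, one_smul]
    exact isRationalClass_ofRatClass _
  have hv_apply : ∀ m, v m = ofRatClassBaseChange (Motives.ComplexPoints A.X) 1 (cb (φι m)) := fun m => by
    rw [hv, Module.Basis.map_apply, hcbσ, hρ, ofRatClassBaseChangeEquiv_apply]
  have hv0 : ∀ m, κ' m = 0 → IsOfHodgeType A.dim A.X 1 1 0 (v m) := by
    intro m hm
    rw [hv_apply, ← BettiUniverse.mem_hodge_piece_iff hHD hI hX (k := 1) (p := 1) (q := 0) rfl]
    exact (hkind (φι m)).1 hm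
  have hv1 : ∀ m, κ' m = 1 → IsOfHodgeType A.dim A.X 1 0 1 (v m) := by
    intro m hm
    rw [hv_apply, ← BettiUniverse.mem_hodge_piece_iff hHD hI hX (k := 1) (p := 0) (q := 1) rfl]
    exact (hkind (φι m)).2 hm
  -- (α) an antisymmetric kind-balanced coefficient function in the adapted letters
  obtain ⟨ax, hax_bal, hax_anti, hcax⟩ := hg.exists_antisymm_kindBalanced_wordEval_eq v κ' hv0 hv1 hp hc
  -- the change of letters to the rational letters
  set G : Matrix _ _ ℂ := eC.toMatrix cbσ with hG
  set G' : Matrix _ _ ℂ := cbσ.toMatrix eC with hG'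
  have hG'G : G' * G = 1 := cbσ.toMatrix_mul_toMatrix_flip eC
  have hve : ∀ m, v m = ∑ i, G i m • eL i := fun m => by
    simp only [hv, heL, Module.Basis.map_apply, ← map_smul, ← map_sum]
    congr 1
    exact (eC.sum_toMatrix_smul_self (v := ⇑cbσ) (j := m)).symm
  have hletters : ∀ j m, avLetters g v (j, m) = ∑ i, G i m • avLetters g eL (j, i) :=
    avLetters_baseChange g G hve
  set aE := colourChangeAt (fun _ : Fin n => G) ax with haE
  have haE_anti : IsAntisymm aE := hax_anti.colourChangeAt _
  have hcaE : wordEval F (avLetters g eL) aE = c := by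
    rw [haE, ← wordEval_eq_wordEval_colourChangeAt F (fun _ : Fin n => G) hletters ax, hcax]
  -- rationality of `aE`
  obtain ⟨q, hq⟩ := hg.exists_rat_wordEval_eq eL heLQ hcQ
  obtain ⟨q', -, haEq⟩ := haE_anti.exists_eq_algebraMap_of_wordEval_eq hFinj (hg.letterBasis eL)
    (q := q) (by rw [AVSlots.coe_letterBasis, hcaE, hFdef, hq])
  have hslice_e : ∀ u, wordSlice aE u = wordRepAt ℂ (fun _ : Fin (2 * p) => G) (wordSlice ax u) :=
    fun u => wordSlice_colourChangeAt (fun _ : Fin n => G) ax u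
  -- the Hodge operator `Θ`: `diag(±1)` in the adapted letters
  obtain ⟨Θ, hΘ⟩ := exists_hodgeTheta (BettiUniverse.hodge hHD (AbelianVariety.isSmoothProjective_holds (A := A)) 1)
  obtain ⟨-, -, hΘ10, hΘ01, -⟩ :=
    UnitaryTheta.theta_facts (BettiUniverse.hodge hHD (AbelianVariety.isSmoothProjective_holds (A := A)) 1) hn1 heff hΘ
  have hΘb : ∀ m, Θ (cbσ m) = (if κ' m = 0 then (1 : ℂ) else -1) • cbσ m := by
    intro m
    rw [hcbσ]
    rcases fin2_cases₇ (κ' m) with h0 | h1'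
    · rw [h0, if_pos rfl, one_smul]
      exact hΘ10 _ ((hkind (φι m)).1 h0)
    · rw [h1', if_neg one_ne_zero, neg_one_smul]
      exact hΘ01 _ ((hkind (φι m)).2 h1')
  have hΘcb : LinearMap.toMatrix cbσ cbσ Θ = kindDiag κ' := by
    ext i m
    rw [LinearMap.toMatrix_apply, hΘb, map_smul, Module.Basis.repr_self, Finsupp.smul_apply,
      Finsupp.single_apply, kindDiag, Matrix.diagonal_apply, smul_eq_mul, mul_ite, mul_one, mul_zero]
    by_cases him : i = m
    · subst him; rw [if_pos rfl]
    · rw [if_neg (Ne.symm him), if_neg him]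
  have hJG : LinearMap.toMatrix eC eC Θ * G = G * kindDiag κ' := by
    rw [← hΘcb, hG, linearMap_toMatrix_mul_basis_toMatrix, basis_toMatrix_mul_linearMap_toMatrix]
  have hΘq : ∀ u : Fin (2 * p) → Fin n, wordDerAt ℂ (fun _ : Fin (2 * p) => LinearMap.toMatrix eC eC Θ)
      (wordSlice (fun w => algebraMap ℚ ℂ (q' w)) u) = 0 := by
    intro u
    rw [← haEq, hslice_e]
    refine wordDerAt_wordRepAt_eq_zero_of_mul_eq ℂ (fun _ : Fin (2 * p) => G) (fun _ => hJG) ?_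
    rw [wordDerAt_const]
    exact wordDer_kindDiag_wordSlice_eq_zero κ' hax_bal u
  -- structure of the adapted basis for `ψ_ℂ` and `φ^*_ℂ`
  set ψC := ψ.form.baseChange ℂ with hψC
  have hiso0 : ∀ i j, ψC (cb (0, i)) (cb (0, j)) = 0 := fun i j => hiso 0 i j
  have hiso1 : ∀ i j, ψC (cb (1, i)) (cb (1, j)) = 0 := fun i j => hiso 1 i j
  have hswap10 : ∀ i j, ψC (cb (1, i)) (cb (0, j)) = -(if j = i then 1 else 0) := fun i j => by
    rw [hψC, ψ.form_baseChange_swap, show (((1 : ℕ) : ℤ)).negOnePow = -1 from Int.negOnePow_one, ← hψC, hdual]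
    split_ifs <;> simp
  have hφKcb : ∀ t ℓ, φK.baseChange ℂ (cb (t, ℓ)) = (if t = 0 then μK else μK') • cb (t, ℓ) := by
    intro t ℓ
    rcases fin2_cases₇ t with rfl | rfl
    · rw [if_pos rfl]; exact Module.End.mem_eigenspace_iff.1 (hKcb ℓ)
    · rw [if_neg one_ne_zero]; exact Module.End.mem_eigenspace_iff.1 (hKcb' ℓ)
  -- a basis of `W_K` made of the letters `cb (0, ℓ)` (for the trace condition of `hSU`)
  obtain ⟨bW, hbW⟩ := exists_basis_eigenspace_of_block cb (f := φK.baseChange ℂ)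
    (ε := fun t => if t = 0 then μK else μK') hφKcb 0 (if_pos rfl) (fun t' ht' => by
      rcases fin2_cases₇ t' with rfl | rfl
      · exact absurd rfl ht'
      · rw [if_neg one_ne_zero]; exact hμK)
  -- every Hodge endomorphism preserves `W̄_K` (`φ^*` is central)
  have hηW' : ∀ η ∈ (BettiUniverse.hodge hHD (AbelianVariety.isSmoothProjective_holds (A := A)) 1).endAlg,
      ∀ y ∈ Module.End.eigenspace (φK.baseChange ℂ) μK', η.baseChange ℂ y ∈ Module.End.eigenspace (φK.baseChange ℂ) μK' := by
    intro η hη y hy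
    have hc : η.baseChange ℂ * φK.baseChange ℂ = φK.baseChange ℂ * η.baseChange ℂ := by
      rw [← LinearMap.baseChange_mul, hZ η hη, LinearMap.baseChange_mul]
    exact UnitaryTheta.apply_mem_eigenspace_of_commute hc hy
  -- the invariance of every slice under the TIED BLOCK-DIAGONAL TRACELESS typed differentials, via `hSU` and THEOREM L-Hg
  have key : ∀ (X : Matrix (Fin n₀) (Fin n₀) ℂ), (∀ i j, blk i ≠ blk j → X i j = 0) → X.trace = 0 →
      (∀ a ∈ T, ∀ b ∈ T, X a a = X b b) → ∀ (u : Fin (2 * p) → Fin n),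
      wordDerAt ℂ (fun _ : Fin (2 * p) => blockLiftGen φι (fun t : Fin 2 => if t = 0 then X else -Xᵀ))
        (wordSlice ax u) = 0 := by
    intro X hXb hXtr hXT u
    set Nf : Fin 2 → Matrix (Fin n₀) (Fin n₀) ℂ := fun t => if t = 0 then X else -Xᵀ with hNf
    have hNf0 : Nf 0 = X := if_pos rfl
    have hNf1 : Nf 1 = -Xᵀ := if_neg one_ne_zero
    set Y := Matrix.toLin cbσ cbσ (blockLiftGen φι Nf) with hYdef
    have hYcb : ∀ t ℓ, Y (cb (t, ℓ)) = ∑ r, Nf t r ℓ • cb (t, r) :=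
      fun t ℓ => toLin_blockLiftGen_apply φι cbσ (⇑cb) hcbσ Nf t ℓ
    have hY0 : ∀ ℓ, Y (cb (0, ℓ)) = ∑ r, X r ℓ • cb (0, r) := fun ℓ => by rw [hYcb, hNf0]
    have hYφ : Y * φK.baseChange ℂ = φK.baseChange ℂ * Y := by
      refine cb.ext fun tl => ?_
      obtain ⟨t, ℓ⟩ := tl
      rw [Module.End.mul_apply, Module.End.mul_apply, hφKcb, map_smul, hYcb, map_sum, Finset.smul_sum]
      exact Finset.sum_congr rfl fun r _ => by rw [map_smul, hφKcb, smul_comm]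
    have hYW' : ∀ y ∈ Module.End.eigenspace (φK.baseChange ℂ) μK', Y y ∈ Module.End.eigenspace (φK.baseChange ℂ) μK' :=
      fun y hy => UnitaryTheta.apply_mem_eigenspace_of_commute hYφ hy
    have hYskew : ∀ x y, ψC (Y x) y + ψC x (Y y) = 0 := by
      have hB : ψC ∘ₗ Y + ψC.compl₂ Y = 0 := by
        refine LinearMap.BilinForm.ext_basis cb fun tk tl => ?_
        obtain ⟨t, k⟩ := tk
        obtain ⟨t', ℓ⟩ := tl
        rw [LinearMap.add_apply, LinearMap.add_apply, LinearMap.comp_apply, LinearMap.compl₂_apply,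
          LinearMap.zero_apply, LinearMap.zero_apply, hYcb, hYcb, map_sum, LinearMap.sum_apply, map_sum]
        simp only [map_smul, LinearMap.smul_apply, smul_eq_mul]
        rcases fin2_cases₇ t with rfl | rfl <;> rcases fin2_cases₇ t' with rfl | rfl
        · simp [hiso0]
        · simp [hNf0, hNf1, hdual, Matrix.neg_apply, Matrix.transpose_apply, mul_ite, Finset.sum_ite_eq,
            Finset.sum_ite_eq']
        · simp [hNf0, hNf1, hswap10, Matrix.neg_apply, Matrix.transpose_apply, mul_ite, Finset.sum_ite_eq,
            Finset.sum_ite_eq']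
        · simp [hiso1]
      intro x y
      have h := LinearMap.congr_fun (LinearMap.congr_fun hB x) y
      simpa only [LinearMap.add_apply, LinearMap.comp_apply, LinearMap.compl₂_apply, LinearMap.zero_apply]
        using h
    -- `Y` on the tied letters: the common scalar
    have hYT : ∀ ℓ ∈ T, ∀ y ∈ Submodule.span ℂ (Set.range fun ℓ' : {ℓ' // ℓ' ∈ T} => cb (0, ℓ'.1)),
        Y y = X ℓ ℓ • y := by
      intro ℓ hℓ y hy
      induction hy using Submodule.span_induction with
      | mem x hx =>
        obtain ⟨⟨ℓ', hℓ'⟩, rfl⟩ := hx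
        rw [hY0, Finset.sum_eq_single ℓ', hXT ℓ' hℓ' ℓ hℓ]
        · intro r _ hr
          rw [hXb r ℓ' (fun h => hr (hT1 ℓ' hℓ' r h)), zero_smul]
        · intro h; exact absurd (Finset.mem_univ ℓ') h
      | zero => rw [map_zero, smul_zero]
      | add x y _ _ hx hy => rw [map_add, hx, hy, smul_add]
      | smul r x _ hx => rw [map_smul, hx, smul_comm]
    -- `Y` commutes with every Hodge endomorphism on the type-`0` letters
    have hcomm0 : ∀ η ∈ (BettiUniverse.hodge hHD (AbelianVariety.isSmoothProjective_holds (A := A)) 1).endAlg,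
        ∀ ℓ, Y (η.baseChange ℂ (cb (0, ℓ))) = η.baseChange ℂ (Y (cb (0, ℓ))) := by
      intro η hη ℓ
      by_cases hℓ : ℓ ∈ T
      · rw [hYT ℓ hℓ _ (hET η hη ℓ hℓ), hYT ℓ hℓ _ (Submodule.subset_span ⟨⟨ℓ, hℓ⟩, rfl⟩), map_smul]
      · obtain ⟨s, hs⟩ := hEU η hη
        rw [hs ℓ hℓ, map_smul, hY0, map_sum, Finset.smul_sum]
        refine Finset.sum_congr rfl fun r _ => ?_
        rw [map_smul]
        by_cases hb : blk r = blk ℓ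
        · have hr : r ∉ T := fun hrT => hℓ ((hT1 r hrT ℓ hb.symm) ▸ hrT)
          rw [hs r hr, hb, smul_comm]
        · rw [hXb r ℓ hb, zero_smul, zero_smul, smul_zero]
    -- … and on the type-`1` letters (adjoint trick + dual expansion)
    have hcomm1 : ∀ η ∈ (BettiUniverse.hodge hHD (AbelianVariety.isSmoothProjective_holds (A := A)) 1).endAlg,
        ∀ ℓ, Y (η.baseChange ℂ (cb (1, ℓ))) = η.baseChange ℂ (Y (cb (1, ℓ))) := by
      intro η hη ℓ
      have hadjE := ψ.adjoint_mem_endAlg hη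
      have hL : Y (η.baseChange ℂ (cb (1, ℓ))) ∈ Module.End.eigenspace (φK.baseChange ℂ) μK' :=
        hYW' _ (hηW' η hη _ (hKcb' ℓ))
      have hR : η.baseChange ℂ (Y (cb (1, ℓ))) ∈ Module.End.eigenspace (φK.baseChange ℂ) μK' :=
        hηW' η hη _ (hYW' _ (hKcb' ℓ))
      rw [eq_sum_form_smul_of_mem_eigenspace cb hμK hKcb hKcb' ψC hdual hL,
        eq_sum_form_smul_of_mem_eigenspace cb hμK hKcb hKcb' ψC hdual hR]
      refine Finset.sum_congr rfl fun i _ => ?_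
      congr 1
      -- `ψ(e_i, Y η y) = −ψ(Y e_i, η y) = −ψ(η† Y e_i, y) = −ψ(Y η† e_i, y) = ψ(η† e_i, Y y) = ψ(e_i, η Y y)`
      have e1 : ψC (cb (0, i)) (Y (η.baseChange ℂ (cb (1, ℓ)))) = -ψC (Y (cb (0, i))) (η.baseChange ℂ (cb (1, ℓ))) :=
        eq_neg_of_add_eq_zero_right (hYskew _ _)
      have e2 : ψC (Y (cb (0, i))) (η.baseChange ℂ (cb (1, ℓ))) =
          ψC ((ψ.adjoint η).baseChange ℂ (Y (cb (0, i)))) (cb (1, ℓ)) := by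
        rw [hψC, ψ.form_baseChange_adjoint_left]
      have e3 : (ψ.adjoint η).baseChange ℂ (Y (cb (0, i))) = Y ((ψ.adjoint η).baseChange ℂ (cb (0, i))) :=
        (hcomm0 _ hadjE i).symm
      have e4 : ψC (Y ((ψ.adjoint η).baseChange ℂ (cb (0, i)))) (cb (1, ℓ)) =
          -ψC ((ψ.adjoint η).baseChange ℂ (cb (0, i))) (Y (cb (1, ℓ))) :=
        eq_neg_of_add_eq_zero_left (hYskew _ _)
      have e5 : ψC ((ψ.adjoint η).baseChange ℂ (cb (0, i))) (Y (cb (1, ℓ))) =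
          ψC (cb (0, i)) (η.baseChange ℂ (Y (cb (1, ℓ)))) := by
        rw [hψC, ψ.form_baseChange_adjoint_left]
      rw [e1, e2, e3, e4, e5, neg_neg]
    have hallη : ∀ η ∈ (BettiUniverse.hodge hHD (AbelianVariety.isSmoothProjective_holds (A := A)) 1).endAlg,
        Y * η.baseChange ℂ = η.baseChange ℂ * Y := by
      intro η hη
      refine cb.ext fun tl => ?_
      obtain ⟨t, ℓ⟩ := tl
      rw [Module.End.mul_apply, Module.End.mul_apply]
      rcases fin2_cases₇ t with rfl | rfl
      · exact hcomm0 η hη ℓ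
      · exact hcomm1 η hη ℓ
    have hall : ∀ θ : A ⟶ A, Y * ((bettiCohomology.map θ.hom.hom.hom 1).hom).baseChange ℂ =
        ((bettiCohomology.map θ.hom.hom.hom 1).hom).baseChange ℂ * Y :=
      fun θ => hallη _ (pullback_mem_endAlg hHD hI θ)
    -- the trace of `Y` on `W_K` is `tr X = 0`
    have hYtr : LinearMap.trace ℂ _ (Y.restrict fun x (hx : x ∈ Module.End.eigenspace (φK.baseChange ℂ) μK) =>
        UnitaryTheta.apply_mem_eigenspace_of_commute (hall φ) hx) = 0 := by
      rw [trace_restrict_eq_of_apply_eq_sum bW hbW _ X (fun ℓ => by rw [hYcb, hNf0]), hXtr]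
    have hYC := hSU Y hall hYskew hYtr
    have hL := wordDerAt_eq_zero_of_mem_hodgeLieC
      (BettiUniverse.hodge hHD (AbelianVariety.isSmoothProjective_holds (A := A)) 1) ψ eQ q' hΘ hΘq hYC u
    rw [← haEq, hslice_e] at hL
    have hYG : ∀ _t : Fin (2 * p), LinearMap.toMatrix eC eC Y * G = G * LinearMap.toMatrix cbσ cbσ Y :=
      fun _ => by rw [hG, linearMap_toMatrix_mul_basis_toMatrix, basis_toMatrix_mul_linearMap_toMatrix]
    have hblk : LinearMap.toMatrix cbσ cbσ Y = blockLiftGen φι Nf := by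
      rw [hYdef, LinearMap.toMatrix_toLin]
    have h3 : wordRepAt ℂ (fun _ : Fin (2 * p) => G)
        (wordDerAt ℂ (fun _ : Fin (2 * p) => blockLiftGen φι Nf) (wordSlice ax u)) = 0 := by
      rw [← hblk, wordRepAt_wordDerAt_of_mul_eq ℂ (fun _ : Fin (2 * p) => G) hYG, hL]
    exact wordRepAt_injective ℂ (g := fun _ : Fin (2 * p) => G) (g' := fun _ : Fin (2 * p) => G')
      (funext fun _ => hG'G) (by rw [h3, map_zero])
  -- the coefficient function, refined to slot-and-type colours
  refine ⟨placeRefineGen φι ax, ?_, fun U X hXb hXtr hXT => ?_⟩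
  · rw [← hcax]
    have hx : (fun x : (Fin n × Fin 2) × Fin n₀ => avLetters g v (x.1.1, φι.symm (x.1.2, x.2))) =
        fun x => avLetters g (fun tl : Fin 2 × Fin n₀ =>
          ofRatClassBaseChange (Motives.ComplexPoints A.X) 1 (cb tl)) (x.1.1, (x.1.2, x.2)) := by
      funext x
      rw [avLetters_apply, avLetters_apply, hv_apply, Equiv.apply_symm_apply]
    rw [← hx]
    exact wordEval_placeRefineGen F φι (avLetters g v) ax
  · exact wordDerAt_placeRefineGen_eq_zero φι (fun t : Fin 2 => if t = 0 then X else -Xᵀ) (key X hXb hXtr hXT) U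

end Invariance

/-! ### §2 THE SOCKET: `S(A)(h)(ℂ) ∩ {det_{W_K} = 1} ⊆ Hg(A)(ℂ)|_{H¹}` for `End(A)` acting block-scalarly on `W_K` with tied rank-one blocks — the displayed `hG` of TABLE X row 20 -/

section SocketT

variable {A : AbelianVariety ℂ} {φ : A ⟶ A} {n d : ℕ} {ι : Type} [Fintype ι] [DecidableEq ι]

/-- `(q : ℂ) • z = q • z` on `V_ℂ`. [folklore] -/
private theorem ratCast_smul₇ {V : Type*} [AddCommGroup V] [Module ℚ V] (q : ℚ) (z : ℂ ⊗[ℚ] V) :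
    (q : ℂ) • z = q • z := by
  rw [← algebraMap_smul ℂ q z, eq_ratCast]

set_option maxHeartbeats 400000 in
open scoped Classical in
/-- **R20-S — THE LIE-TO-GROUP PASSAGE FOR WEIL TYPE WITH `End(A)` ACTING BLOCK-SCALARLY ON `W_K` WITH TIED RANK-ONE BLOCKS**
(socket `hG` of the TABLE X census file `SixfoldTableXCensusWeilSquareProductRowDomain`, row 20 `Y₄ × E_K²`). Let `(A, φ)`
be of Weil type `(n, d)` with `φ` CENTRAL in `End(A)` (`hφC`); `φ_E ∈ End(A)` with colours `μ : ι → ℂ` (injective) whose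
eigenspaces `W_{μ k}` of `φ_{E,ℂ}^*` satisfy `W_{μ k} ≤ W_K := ker(φ^*_ℂ − i√d) ≤ ⨆_k W_{μ k}`; a finite set `S` of TIED colours,
each with `dim W_{μ k} = 1`, an untied colour `k₀ ∉ S` with `W_{μ k₀} ≠ 0`, ties `hσ` (for `k, k' ∈ S` some pull-back `θ^*_ℂ`
maps a vector of `W_{μ k}` to a non-zero vector of `W_{μ k'}` — row 20: the swap of the two `E`-factors), and the shape of
the endomorphisms on `W_K`: every pull-back `θ^*_ℂ` acts on each untied `W_{μ k}` by a scalar (`hEndU`; row 20: `End⁰(Y₄) = K`)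
and preserves `⨆_{k ∈ S} W_{μ k}` (`hEndT`); `ψ` a polarization of `H¹(A(ℂ); ℚ)` with the DISPLAYED Lie hypothesis `hSU`
(«every operator commuting with ALL `θ^*_ℂ`, `ψ_ℂ`-skew, with trace `0` on `W_K`, lies in `Lie Hg(H¹A) ⊗ ℂ`»), and
`h ∈ B¹(A) ⊗ ℂ` with `Q_h` non-degenerate and `φ^*` a `d`-similitude of `Q_h`. Then every
`u ∈ S(A)(h)(ℂ) = unitaryCentralizerGroup A h` with `det(u | W_K) = 1` lies in `Hg(A)(ℂ)|_{H¹}`. Proof: in the letters of S2-T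
(`φ^*` is `ψ`-skew because it is central, S2-T §1) the matrix `M` of `u|_{W_K}` is block-diagonal (`u` commutes with `φ_E^*`),
TIED (`u` commutes with the ties) with `det M = 1`; `v = (M, (M⁻¹)ᵀ)` commutes with `φ_ℂ` and with EVERY `θ^*_ℂ` (on `W_K` it
is `u`; on `W̄_K` by the adjoint trick), preserves `ψ_ℂ`; by §1 and S1-T
(`wordRepAt_mixedGrpFamily_eq_self_of_forall_tiedBlockDiag_trace_of_det_eq_one`) `⋀•(v^{⊕(a+1)})` fixes the Hodge classes
of every power, so `v ∈ Hg|_{H¹} ≤ S(A)(h)`; `u` and `v` agree on `W_K`, `W̄_K` is `Q_h`-isotropic, so `u = v` (S3 §3).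
NOT proved here: `hSU` (the row's Lie theorem), HC for any row. [cite: Deligne1982HodgeCycles, I §3 Prop. 3.4 and 3.6]
[cite: vanGeemen1994HodgeAV, 6.9 and Lemma 6.10] [cite: Milne1999LefschetzClasses, §1 p. 644 and §4 p. 659]
[cite: GoodmanWallachGTM255, Thm. 2.2.2 and Thm. 2.2.7 (2)] [cite: MoonenZarhin1999LowDim, §5 (5.11)] -/
theorem IsWeilType.mem_hodgeGroupOne_of_mem_unitaryCentralizerGroup_tied_of_hodgeLieC [HodgeTensorFacts.{0, 0}]
    (hW : IsWeilType A φ n d) (hφC : ∀ θ : A ⟶ A, θ ≫ φ = φ ≫ θ) (φE : A ⟶ A) (μ : ι → ℂ)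
    (hinj : Function.Injective μ)
    (hKle : ∀ k, Module.End.eigenspace (((bettiCohomology.map φE.hom.hom.hom 1).hom).baseChange ℂ) (μ k) ≤
      Module.End.eigenspace (((bettiCohomology.map φ.hom.hom.hom 1).hom).baseChange ℂ) (Complex.I * (Real.sqrt d : ℂ)))
    (hKge : Module.End.eigenspace (((bettiCohomology.map φ.hom.hom.hom 1).hom).baseChange ℂ) (Complex.I * (Real.sqrt d : ℂ)) ≤
      ⨆ k, Module.End.eigenspace (((bettiCohomology.map φE.hom.hom.hom 1).hom).baseChange ℂ) (μ k))
    (S : Finset ι)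
    (hS1 : ∀ k ∈ S, Module.finrank ℂ
      ↥(Module.End.eigenspace (((bettiCohomology.map φE.hom.hom.hom 1).hom).baseChange ℂ) (μ k)) = 1)
    {k₀ : ι} (hk₀ : k₀ ∉ S)
    (hW₀ : Module.End.eigenspace (((bettiCohomology.map φE.hom.hom.hom 1).hom).baseChange ℂ) (μ k₀) ≠ ⊥)
    (hσ : ∀ k ∈ S, ∀ k' ∈ S, ∃ (θ : A ⟶ A) (x : ℂ ⊗[ℚ] bettiCohomology A.X 1),
      x ∈ Module.End.eigenspace (((bettiCohomology.map φE.hom.hom.hom 1).hom).baseChange ℂ) (μ k) ∧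
      ((bettiCohomology.map θ.hom.hom.hom 1).hom).baseChange ℂ x ≠ 0 ∧
      ((bettiCohomology.map θ.hom.hom.hom 1).hom).baseChange ℂ x ∈
        Module.End.eigenspace (((bettiCohomology.map φE.hom.hom.hom 1).hom).baseChange ℂ) (μ k'))
    (hEndU : ∀ (θ : A ⟶ A) (k : ι), k ∉ S → ∃ s : ℂ,
      ∀ x ∈ Module.End.eigenspace (((bettiCohomology.map φE.hom.hom.hom 1).hom).baseChange ℂ) (μ k),
        ((bettiCohomology.map θ.hom.hom.hom 1).hom).baseChange ℂ x = s • x)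
    (hEndT : ∀ (θ : A ⟶ A),
      ∀ x ∈ ⨆ k ∈ S, Module.End.eigenspace (((bettiCohomology.map φE.hom.hom.hom 1).hom).baseChange ℂ) (μ k),
        ((bettiCohomology.map θ.hom.hom.hom 1).hom).baseChange ℂ x ∈
          ⨆ k ∈ S, Module.End.eigenspace (((bettiCohomology.map φE.hom.hom.hom 1).hom).baseChange ℂ) (μ k))
    (ψ : (BettiUniverse.hodge exists_isReal_hodgeModel_holds (AbelianVariety.isSmoothProjective_holds (A := A)) 1).Polarization)
    (hSU : ∀ (Y : Module.End ℂ (ℂ ⊗[ℚ] bettiCohomology A.X 1))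
      (hall : ∀ θ : A ⟶ A, Y * ((bettiCohomology.map θ.hom.hom.hom 1).hom).baseChange ℂ =
        ((bettiCohomology.map θ.hom.hom.hom 1).hom).baseChange ℂ * Y),
      (∀ x y, ψ.form.baseChange ℂ (Y x) y + ψ.form.baseChange ℂ x (Y y) = 0) →
      LinearMap.trace ℂ _ (Y.restrict fun x (hx : x ∈ Module.End.eigenspace
          (((bettiCohomology.map φ.hom.hom.hom 1).hom).baseChange ℂ) (Complex.I * (Real.sqrt d : ℂ))) =>
        UnitaryTheta.apply_mem_eigenspace_of_commute (hall φ) hx) = 0 →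
      Y ∈ (BettiUniverse.hodge exists_isReal_hodgeModel_holds (AbelianVariety.isSmoothProjective_holds (A := A)) 1).hodgeLieC)
    {h : complexBetti A.X 2} (hh : h ∈ hodgeClassSpan A.dim A.X 1)
    (hnd : ∀ x : complexBetti A.X 1, (∀ y, Motives.polarizationPairingOne A.X h (A.dim - 1) x y = 0) → x = 0)
    (hφQ : ∀ x y, Motives.polarizationPairingOne A.X h (A.dim - 1) (pullbackOne A φ x) (pullbackOne A φ y) =
      (d : ℂ) • Motives.polarizationPairingOne A.X h (A.dim - 1) x y)
    (u : complexBetti A.X 1 ≃ₗ[ℂ] complexBetti A.X 1) (hu : u ∈ unitaryCentralizerGroup A h)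
    (hdet : detOnEigenspace u (pullbackOne A φ) (fun x ↦ (mem_centralizerGroup_iff.1 hu.1) φ x)
      (Complex.I * (Real.sqrt d : ℂ)) = 1) :
    u ∈ hodgeGroupOne A.dim A.X := by
  classical
  -- the setting
  have hHD : exists_isReal_hodgeModel := exists_isReal_hodgeModel_holds
  have hI : hodgePQ_independent_of_hodgeModel := hodgePQ_independent_of_hodgeModel_holds
  have hX : IsSmoothProjective A.dim A.X := AbelianVariety.isSmoothProjective_holds
  haveI : Module.Finite ℚ (bettiCohomology A.X 1) := finite_bettiCohomology_one A
  have heff := BettiUniverse.hodge_isEffective hHD hX 1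
  set φQ : Module.End ℚ (bettiCohomology A.X 1) := (bettiCohomology.map φ.hom.hom.hom 1).hom with hφQdef
  set φEQ : Module.End ℚ (bettiCohomology A.X 1) := (bettiCohomology.map φE.hom.hom.hom 1).hom with hφEQdef
  set μK : ℂ := Complex.I * (Real.sqrt d : ℂ) with hμKdef
  have hμK0 : μK ≠ 0 := mul_ne_zero Complex.I_ne_zero
    (Complex.ofReal_ne_zero.2 (Real.sqrt_ne_zero'.2 (Nat.cast_pos.2 hW.d_pos)))
  have hμKne : -μK ≠ μK := fun h' => hμK0 (by
    have h2 : (2 : ℂ) * μK = 0 := by rw [two_mul]; nth_rw 1 [← h']; exact neg_add_cancel μK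
    exact (mul_eq_zero.1 h2).resolve_left two_ne_zero)
  have hμK2 : μK * μK = -(d : ℂ) := by
    rw [hμKdef, mul_mul_mul_comm, Complex.I_mul_I, ← Complex.ofReal_mul, Real.mul_self_sqrt (Nat.cast_nonneg d),
      Complex.ofReal_natCast, neg_one_mul]
  have hμ : μK ^ 2 = -(((d : ℚ)) : ℂ) := by rw [sq, hμK2]; push_cast; ring
  set ρ := ofRatClassBaseChangeEquiv hX 1 with hρ
  set Q := Motives.polarizationPairingOne A.X h (A.dim - 1) with hQdef
  have hρθ : ∀ (θ : A ⟶ A) z, ρ (((bettiCohomology.map θ.hom.hom.hom 1).hom).baseChange ℂ z) = pullbackOne A θ (ρ z) :=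
    fun θ z => by
    rw [hρ, ofRatClassBaseChangeEquiv_apply, ofRatClassBaseChangeEquiv_apply, ofRatClassBaseChange_baseChange_bettiMapHom]
  have hρφ : ∀ z, ρ (φQ.baseChange ℂ z) = pullbackOne A φ (ρ z) := hρθ φ
  have hρφE : ∀ z, ρ (φEQ.baseChange ℂ z) = pullbackOne A φE (ρ z) := hρθ φE
  -- Hodge endomorphisms: pull-backs, and `φ^*` is central among them (Riemann)
  have hφQE : φQ ∈ (BettiUniverse.hodge hHD (AbelianVariety.isSmoothProjective_holds (A := A)) 1).endAlg :=
    pullback_mem_endAlg hHD hI φ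
  have hφEQE : φEQ ∈ (BettiUniverse.hodge hHD (AbelianVariety.isSmoothProjective_holds (A := A)) 1).endAlg :=
    pullback_mem_endAlg hHD hI φE
  have hθφ : ∀ θ : A ⟶ A, (bettiCohomology.map θ.hom.hom.hom 1).hom * φQ = φQ * (bettiCohomology.map θ.hom.hom.hom 1).hom :=
    fun θ => bettiMapHom_comm_of_comm (hφC θ)
  have hZ : ∀ η ∈ (BettiUniverse.hodge hHD (AbelianVariety.isSmoothProjective_holds (A := A)) 1).endAlg,
      η * φQ = φQ * η := by
    intro η hη
    obtain ⟨c, F, rfl⟩ := exists_eq_smul_bettiMapHom_of_mem_endAlg hη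
    rw [smul_mul_assoc, hθφ F, mul_smul_comm]
  have hθW : ∀ (θ : A ⟶ A) (c : ℂ), ∀ x ∈ Module.End.eigenspace (φQ.baseChange ℂ) c,
      ((bettiCohomology.map θ.hom.hom.hom 1).hom).baseChange ℂ x ∈ Module.End.eigenspace (φQ.baseChange ℂ) c := by
    intro θ c x hx
    have hc : ((bettiCohomology.map θ.hom.hom.hom 1).hom).baseChange ℂ * φQ.baseChange ℂ =
        φQ.baseChange ℂ * ((bettiCohomology.map θ.hom.hom.hom 1).hom).baseChange ℂ := by
      rw [← LinearMap.baseChange_mul, hθφ θ, LinearMap.baseChange_mul]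
    exact UnitaryTheta.apply_mem_eigenspace_of_commute hc hx
  -- `φ^*` is `ψ`-skew (it is central: S2-T §1) and `φ^* ∘ φ^* = −d`
  have hdQ : (0 : ℚ) < d := Nat.cast_pos.2 hW.d_pos
  have hφ2Q : φQ * φQ = -((d : ℚ) • (1 : Module.End ℚ (bettiCohomology A.X 1))) := bettiMapHom_mul_self hW.sq_eq
  have hφskew : ∀ v w, ψ.form (φQ v) w + ψ.form v (φQ w) = 0 :=
    ψ.form_apply_add_form_apply_eq_zero_of_forall_commute hφQE (fun a ha => (hZ a ha).symm) hdQ hφ2Q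
  -- the letters (S2-T)
  obtain ⟨n₀, cb, κ, blk, hcbE, hKcb, hKcb', hcb0, hcb1, hdual, hiso, hspan⟩ :=
    BlockedTheta.exists_adaptedDualBasis (BettiUniverse.hodge hHD (AbelianVariety.isSmoothProjective_holds (A := A)) 1)
      Nat.cast_one heff ψ hφQE hdQ hφ2Q hφskew hμ hφEQE μ hinj hKle hKge
  have hφcb : ∀ t ℓ, φQ.baseChange ℂ (cb (t, ℓ)) = (if t = 0 then μK else -μK) • cb (t, ℓ) := by
    intro t ℓ
    rcases fin2_cases₇ t with rfl | rfl
    · rw [if_pos rfl]; exact Module.End.mem_eigenspace_iff.1 (hKcb ℓ)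
    · rw [if_neg one_ne_zero]; exact Module.End.mem_eigenspace_iff.1 (hKcb' ℓ)
  have hφEcb0 : ∀ ℓ, φEQ.baseChange ℂ (cb (0, ℓ)) = μ (blk ℓ) • cb (0, ℓ) := fun ℓ =>
    Module.End.mem_eigenspace_iff.1 (hcbE ℓ)
  -- the tied letters: those of the tied colours; each is alone in its colour
  set T : Finset (Fin n₀) := Finset.univ.filter fun ℓ => blk ℓ ∈ S with hTdef
  have hTmem : ∀ ℓ, ℓ ∈ T ↔ blk ℓ ∈ S := fun ℓ => by simp [hTdef]
  have hT1 : ∀ a ∈ T, ∀ b, blk b = blk a → b = a := by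
    intro a ha b hba
    have hk : blk a ∈ S := (hTmem a).1 ha
    -- the letters of colour `blk a` are independent in a line
    set fam : {ℓ : Fin n₀ // blk ℓ = blk a} →
        ↥(Module.End.eigenspace (φEQ.baseChange ℂ) (μ (blk a))) := fun ℓ => ⟨cb (0, ℓ.1), by
          have h := hcbE ℓ.1; rwa [ℓ.2] at h⟩ with hfam
    have hli : LinearIndependent ℂ fam := by
      refine LinearIndependent.of_comp (Module.End.eigenspace (φEQ.baseChange ℂ) (μ (blk a))).subtype ?_
      exact cb.linearIndependent.comp (fun ℓ : {ℓ : Fin n₀ // blk ℓ = blk a} => ((0 : Fin 2), ℓ.1))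
        fun ℓ ℓ' hll => Subtype.ext (by simpa using hll)
    have hcard := hli.fintype_card_le_finrank
    rw [hS1 _ hk] at hcard
    have hsub : Subsingleton {ℓ : Fin n₀ // blk ℓ = blk a} := Fintype.card_le_one_iff_subsingleton.1 hcard
    have h := hsub.elim ⟨b, hba⟩ ⟨a, rfl⟩
    exact congrArg Subtype.val h
  -- an untied letter
  obtain ⟨i₀, hi₀⟩ : ∃ i₀ : Fin n₀, i₀ ∉ T := by
    by_contra hnone
    apply hW₀
    rw [eq_bot_iff]
    refine (hspan k₀).trans ?_
    rw [Submodule.span_le]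
    rintro _ ⟨⟨ℓ, hℓ⟩, rfl⟩
    exact absurd ((hTmem ℓ).1 (not_not.1 fun h => hnone ⟨ℓ, h⟩)) (by rw [hℓ]; exact hk₀)
  -- the span of the tied letters contains every tied colour block
  have hspanT : ∀ k ∈ S, Module.End.eigenspace (φEQ.baseChange ℂ) (μ k) ≤
      Submodule.span ℂ (Set.range fun ℓ' : {ℓ' // ℓ' ∈ T} => cb (0, ℓ'.1)) := by
    intro k hk
    refine (hspan k).trans (Submodule.span_mono ?_)
    rintro _ ⟨⟨ℓ, hℓ⟩, rfl⟩
    exact ⟨⟨ℓ, (hTmem ℓ).2 (hℓ ▸ hk)⟩, rfl⟩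
  have hsupT : (⨆ k ∈ S, Module.End.eigenspace (φEQ.baseChange ℂ) (μ k)) ≤
      Submodule.span ℂ (Set.range fun ℓ' : {ℓ' // ℓ' ∈ T} => cb (0, ℓ'.1)) :=
    iSup₂_le fun k hk => hspanT k hk
  have hTsup : ∀ ℓ ∈ T, cb (0, ℓ) ∈ ⨆ k ∈ S, Module.End.eigenspace (φEQ.baseChange ℂ) (μ k) := fun ℓ hℓ =>
    Submodule.mem_iSup_of_mem (blk ℓ) (Submodule.mem_iSup_of_mem ((hTmem ℓ).1 hℓ) (hcbE ℓ))
  -- a tied colour block is the line of its letter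
  have hline : ∀ a ∈ T, ∀ x ∈ Module.End.eigenspace (φEQ.baseChange ℂ) (μ (blk a)), ∃ c : ℂ, x = c • cb (0, a) := by
    intro a ha x hx
    have hx' := hspan (blk a) hx
    rw [Submodule.mem_span_range_iff_exists_fun] at hx'
    obtain ⟨c, rfl⟩ := hx'
    refine ⟨∑ ℓ, c ℓ, ?_⟩
    rw [Finset.sum_smul]
    exact Finset.sum_congr rfl fun ℓ _ => by rw [hT1 a ha ℓ.1 ℓ.2]
  -- the letter shape of the Hodge endomorphisms (Riemann + `hEndU` ∕ `hEndT`)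
  have hEU : ∀ η ∈ (BettiUniverse.hodge hHD (AbelianVariety.isSmoothProjective_holds (A := A)) 1).endAlg,
      ∃ s : ι → ℂ, ∀ ℓ, ℓ ∉ T → η.baseChange ℂ (cb (0, ℓ)) = s (blk ℓ) • cb (0, ℓ) := by
    intro η hη
    obtain ⟨c, F, rfl⟩ := exists_eq_smul_bettiMapHom_of_mem_endAlg hη
    choose! s hs using hEndU F
    refine ⟨fun k => (c : ℂ) * s k, fun ℓ hℓ => ?_⟩
    have hk : blk ℓ ∉ S := fun h => hℓ ((hTmem ℓ).2 h)
    rw [LinearMap.baseChange_smul, LinearMap.smul_apply, hs (blk ℓ) hk _ (hcbE ℓ), ← ratCast_smul₇, smul_smul]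
  have hET : ∀ η ∈ (BettiUniverse.hodge hHD (AbelianVariety.isSmoothProjective_holds (A := A)) 1).endAlg,
      ∀ ℓ ∈ T, η.baseChange ℂ (cb (0, ℓ)) ∈ Submodule.span ℂ (Set.range fun ℓ' : {ℓ' // ℓ' ∈ T} => cb (0, ℓ'.1)) := by
    intro η hη ℓ hℓ
    obtain ⟨c, F, rfl⟩ := exists_eq_smul_bettiMapHom_of_mem_endAlg hη
    rw [LinearMap.baseChange_smul, LinearMap.smul_apply]
    exact Submodule.smul_of_tower_mem _ c (hsupT (hEndT F _ (hTsup ℓ hℓ)))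
  -- the letters in `H¹(A(ℂ); ℂ)`
  set xb : Module.Basis (Fin 2 × Fin n₀) ℂ (complexBetti A.X 1) := cb.map ρ with hxb
  have hxb_apply : ∀ tl, xb tl = ρ (cb tl) := fun tl => by rw [hxb, Module.Basis.map_apply]
  have hφxb : ∀ t ℓ, pullbackOne A φ (xb (t, ℓ)) = (if t = 0 then μK else -μK) • xb (t, ℓ) := fun t ℓ => by
    rw [hxb_apply, ← hρφ, hφcb, map_smul]
  have hφExb0 : ∀ ℓ, pullbackOne A φE (xb (0, ℓ)) = μ (blk ℓ) • xb (0, ℓ) := fun ℓ => by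
    rw [hxb_apply, ← hρφE, hφEcb0, map_smul]
  -- bases of `W_K` on both sides made of the letters
  obtain ⟨bW, hbW⟩ := exists_basis_eigenspace_of_block cb (f := φQ.baseChange ℂ)
    (ε := fun t => if t = 0 then μK else -μK) hφcb 0 (if_pos rfl) (fun t' ht' => by
      rcases fin2_cases₇ t' with rfl | rfl
      · exact absurd rfl ht'
      · rw [if_neg one_ne_zero]; exact hμKne)
  obtain ⟨bWc, hbWc⟩ := exists_basis_eigenspace_of_block xb (f := pullbackOne A φ)
    (ε := fun t => if t = 0 then μK else -μK) hφxb 0 (if_pos rfl) (fun t' ht' => by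
      rcases fin2_cases₇ t' with rfl | rfl
      · exact absurd rfl ht'
      · rw [if_neg one_ne_zero]; exact hμKne)
  have hWexp : ∀ (x) (hx : x ∈ Module.End.eigenspace (φQ.baseChange ℂ) μK),
      x = ∑ r, bW.repr ⟨x, hx⟩ r • cb (0, r) := by
    intro x hx
    have hs := congrArg Subtype.val (bW.sum_repr ⟨x, hx⟩)
    rw [Submodule.coe_sum] at hs
    change _ = x at hs
    nth_rw 1 [← hs]
    exact Finset.sum_congr rfl fun r _ => by rw [Submodule.coe_smul, hbW]
  -- the matrix `M` of `u|_W_K` on the letters; block-diagonal; `det M = 1`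
  have huθ : ∀ (θ : A ⟶ A) z, u (pullbackOne A θ z) = pullbackOne A θ (u z) := fun θ z =>
    (mem_centralizerGroup_iff.1 hu.1) θ z
  have huW : ∀ x ∈ Module.End.eigenspace (pullbackOne A φ) μK, (u : complexBetti A.X 1 →ₗ[ℂ] complexBetti A.X 1) x ∈
      Module.End.eigenspace (pullbackOne A φ) μK :=
    fun x hx => VanGeemen1994.mapsTo_eigenspace_of_comm (huθ φ) μK hx
  have hxbW : ∀ ℓ, xb (0, ℓ) ∈ Module.End.eigenspace (pullbackOne A φ) μK := fun ℓ =>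
    Module.End.mem_eigenspace_iff.2 (by rw [hφxb, if_pos rfl])
  set M : Matrix (Fin n₀) (Fin n₀) ℂ := Matrix.of fun r ℓ => bWc.repr ⟨u (xb (0, ℓ)), huW _ (hxbW ℓ)⟩ r with hMdef
  have hMu : ∀ ℓ, u (xb (0, ℓ)) = ∑ r, M r ℓ • xb (0, r) := fun ℓ => by
    have hs := congrArg Subtype.val (bWc.sum_repr ⟨u (xb (0, ℓ)), huW _ (hxbW ℓ)⟩)
    rw [Submodule.coe_sum] at hs
    change _ = u (xb (0, ℓ)) at hs
    rw [← hs]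
    exact Finset.sum_congr rfl fun r _ => by rw [Submodule.coe_smul, hbWc, hMdef, Matrix.of_apply]
  have hMb : ∀ r ℓ, blk r ≠ blk ℓ → M r ℓ = 0 := by
    intro r ℓ hb
    have hli : LinearIndependent ℂ fun r : Fin n₀ => xb (0, r) :=
      xb.linearIndependent.comp (fun r => (0, r)) fun r r' h' => by simpa using h'
    exact matrix_entry_eq_zero_of_comm_of_eigen hli (f := pullbackOne A φE)
      (Y := (u : complexBetti A.X 1 →ₗ[ℂ] complexBetti A.X 1)) (ε := fun r => μ (blk r)) hφExb0 M
      (fun ℓ => by rw [LinearEquiv.coe_coe, hMu]) (fun ℓ => by rw [LinearEquiv.coe_coe, huθ]) (hinj.ne hb)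
  have hdetM : M.det = 1 := by
    rw [← hdet]
    unfold detOnEigenspace
    exact (det_restrict_eq_of_apply_eq_sum bWc hbWc _ M hMu).symm
  have hMunit : IsUnit M.det := by rw [hdetM]; exact isUnit_one
  have hMinvM : M⁻¹ * M = 1 := Matrix.nonsing_inv_mul M hMunit
  have hMinvb : ∀ r ℓ, blk r ≠ blk ℓ → M⁻¹ r ℓ = 0 := fun r ℓ hb =>
    nonsing_inv_apply_eq_zero_of_blockDiag blk hinj hMb hMunit hb
  -- `M` on a tied letter is a scalar, and the scalars of two tied letters agree (the ties)
  have hMdiagT : ∀ a ∈ T, u (xb (0, a)) = M a a • xb (0, a) := by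
    intro a ha
    rw [hMu, Finset.sum_eq_single a]
    · intro r _ hr
      rw [hMb r a (fun h => hr (hT1 a ha r h)), zero_smul]
    · intro h; exact absurd (Finset.mem_univ a) h
  have hMT : ∀ a ∈ T, ∀ b ∈ T, M a a = M b b := by
    intro a ha b hb
    obtain ⟨θ, x, hx, hθx0, hθx⟩ := hσ (blk a) ((hTmem a).1 ha) (blk b) ((hTmem b).1 hb)
    obtain ⟨c, rfl⟩ := hline a ha x hx
    have hc0 : c ≠ 0 := by rintro rfl; exact hθx0 (by rw [zero_smul, map_zero])
    set θQ := ((bettiCohomology.map θ.hom.hom.hom 1).hom).baseChange ℂ with hθQ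
    have hθa : θQ (cb (0, a)) ∈ Module.End.eigenspace (φEQ.baseChange ℂ) (μ (blk b)) := by
      have h := Submodule.smul_mem _ c⁻¹ hθx
      rwa [map_smul, smul_smul, inv_mul_cancel₀ hc0, one_smul] at h
    obtain ⟨c', hc'⟩ := hline b hb _ hθa
    have hc'0 : c' ≠ 0 := by
      rintro rfl
      apply hθx0
      rw [map_smul, hc', zero_smul, smul_zero]
    -- transport to `H¹(A(ℂ); ℂ)`: `θ^* xb_a = c' xb_b`
    have hθxb : pullbackOne A θ (xb (0, a)) = c' • xb (0, b) := by
      rw [hxb_apply, ← hρθ, ← hθQ, hc', map_smul, hxb_apply]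
    have h1 : u (pullbackOne A θ (xb (0, a))) = (c' * M b b) • xb (0, b) := by
      rw [hθxb, map_smul, hMdiagT b hb, smul_smul]
    have h2 : pullbackOne A θ (u (xb (0, a))) = (M a a * c') • xb (0, b) := by
      rw [hMdiagT a ha, map_smul, hθxb, smul_smul]
    have h3 : (c' * M b b) • xb (0, b) = (M a a * c') • xb (0, b) := by rw [← h1, huθ, h2]
    have h4 := sub_eq_zero.2 h3
    rw [← sub_smul, smul_eq_zero] at h4
    rcases h4 with h4 | h4
    · have h5 : c' * (M b b - M a a) = 0 := by rw [mul_sub, ← h4]; ring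
      rcases mul_eq_zero.1 h5 with h6 | h6
      · exact absurd h6 hc'0
      · exact (sub_eq_zero.1 h6).symm
    · exact absurd h4 (xb.ne_zero _)
  -- the operator `v₀ = (M, (M⁻¹)ᵀ)` on `V_ℂ = W_K ⊕ W̄_K`
  set Gm : Fin 2 → Matrix (Fin n₀) (Fin n₀) ℂ := fun t => if t = 0 then M else (M⁻¹)ᵀ with hGm
  have hGm0 : Gm 0 = M := if_pos rfl
  have hGm1 : Gm 1 = (M⁻¹)ᵀ := if_neg one_ne_zero
  set cbr : Module.Basis (Fin n₀ × Fin 2) ℂ (ℂ ⊗[ℚ] bettiCohomology A.X 1) :=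
    cb.reindex (Equiv.prodComm (Fin 2) (Fin n₀)) with hcbr
  have hcbr_apply : ∀ ℓ t, cbr (ℓ, t) = cb (t, ℓ) := fun ℓ t => by
    rw [hcbr, Module.Basis.reindex_apply]; rfl
  set P : Matrix (Fin n₀ × Fin 2) (Fin n₀ × Fin 2) ℂ := Matrix.blockDiagonal Gm with hP
  have hPunit : IsUnit (LinearMap.toMatrix cbr cbr (Matrix.toLin cbr cbr P)).det := by
    rw [LinearMap.toMatrix_toLin, hP, Matrix.det_blockDiagonal, Fin.prod_univ_two, hGm0, hGm1, Matrix.det_transpose,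
      Matrix.det_nonsing_inv, hdetM, Ring.inverse_one, one_mul]
    exact isUnit_one
  set v₀ : (ℂ ⊗[ℚ] bettiCohomology A.X 1) ≃ₗ[ℂ] (ℂ ⊗[ℚ] bettiCohomology A.X 1) :=
    LinearEquiv.ofIsUnitDet hPunit with hv₀
  have hv₀cb : ∀ t ℓ, v₀ (cb (t, ℓ)) = ∑ r, Gm t r ℓ • cb (t, r) := fun t ℓ => by
    rw [hv₀, LinearEquiv.ofIsUnitDet_apply, ← hcbr_apply, Matrix.toLin_self, Fintype.sum_prod_type_right,
      Finset.sum_eq_single t]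
    · exact Finset.sum_congr rfl fun r _ => by rw [hP, Matrix.blockDiagonal_apply_eq, hcbr_apply]
    · intro t' _ ht'
      exact Finset.sum_eq_zero fun r _ => by rw [hP, Matrix.blockDiagonal_apply_ne _ _ _ ht', zero_smul]
    · intro ht; exact absurd (Finset.mem_univ t) ht
  -- `v₀` commutes with `φ_ℂ`
  have hv₀φ : (v₀ : Module.End ℂ (ℂ ⊗[ℚ] bettiCohomology A.X 1)) * φQ.baseChange ℂ =
      φQ.baseChange ℂ * (v₀ : Module.End ℂ (ℂ ⊗[ℚ] bettiCohomology A.X 1)) := by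
    refine cb.ext fun tl => ?_
    obtain ⟨t, ℓ⟩ := tl
    rw [Module.End.mul_apply, Module.End.mul_apply, LinearEquiv.coe_coe, hφcb, map_smul, hv₀cb, map_sum,
      Finset.smul_sum]
    exact Finset.sum_congr rfl fun r _ => by rw [map_smul, hφcb, smul_comm]
  have hv₀W : ∀ x ∈ Module.End.eigenspace (φQ.baseChange ℂ) μK, v₀ x ∈ Module.End.eigenspace (φQ.baseChange ℂ) μK :=
    fun x hx => UnitaryTheta.apply_mem_eigenspace_of_commute hv₀φ hx
  have hv₀W' : ∀ x ∈ Module.End.eigenspace (φQ.baseChange ℂ) (-μK),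
      v₀ x ∈ Module.End.eigenspace (φQ.baseChange ℂ) (-μK) :=
    fun x hx => UnitaryTheta.apply_mem_eigenspace_of_commute hv₀φ hx
  -- `v₀` preserves `ψ_ℂ`
  set ψC := ψ.form.baseChange ℂ with hψC
  have hiso0 : ∀ i j, ψC (cb (0, i)) (cb (0, j)) = 0 := fun i j => hiso 0 i j
  have hiso1 : ∀ i j, ψC (cb (1, i)) (cb (1, j)) = 0 := fun i j => hiso 1 i j
  have hswap10 : ∀ i j, ψC (cb (1, i)) (cb (0, j)) = -(if j = i then 1 else 0) := fun i j => by
    rw [hψC, ψ.form_baseChange_swap, show (((1 : ℕ) : ℤ)).negOnePow = -1 from Int.negOnePow_one, ← hψC, hdual]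
    split_ifs <;> simp
  have bilin_sum : ∀ (a b : Fin n₀ → ℂ) (e f : Fin n₀ → ℂ ⊗[ℚ] bettiCohomology A.X 1),
      ψC (∑ r, a r • e r) (∑ s, b s • f s) = ∑ r, ∑ s, (a r * b s) • ψC (e r) (f s) := by
    intro a b e f
    rw [LinearMap.map_sum₂]
    refine Finset.sum_congr rfl fun r _ => ?_
    rw [LinearMap.map_smul₂, map_sum, Finset.smul_sum]
    refine Finset.sum_congr rfl fun s' _ => ?_
    rw [map_smul, smul_smul]
  have hv₀ψ : ∀ x y, ψC (v₀ x) (v₀ y) = ψC x y := by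
    have hB : ψC.compl₁₂ (v₀ : Module.End ℂ (ℂ ⊗[ℚ] bettiCohomology A.X 1))
        (v₀ : Module.End ℂ (ℂ ⊗[ℚ] bettiCohomology A.X 1)) = ψC := by
      refine LinearMap.BilinForm.ext_basis cb fun tk tl => ?_
      obtain ⟨t, k⟩ := tk
      obtain ⟨t', ℓ⟩ := tl
      rw [LinearMap.compl₁₂_apply, LinearEquiv.coe_coe, hv₀cb, hv₀cb, bilin_sum]
      rcases fin2_cases₇ t with rfl | rfl <;> rcases fin2_cases₇ t' with rfl | rfl
      · simp only [hiso0, smul_zero, Finset.sum_const_zero]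
      · have e1 : ∀ r : Fin n₀, ∑ s, (Gm 0 r k * Gm 1 s ℓ) • ψC (cb (0, r)) (cb (1, s)) = M r k * M⁻¹ ℓ r := by
          intro r
          rw [Finset.sum_eq_single r]
          · rw [hdual, if_pos rfl, smul_eq_mul, mul_one, hGm0, hGm1, Matrix.transpose_apply]
          · intro s _ hs
            rw [hdual, if_neg (Ne.symm hs), smul_zero]
          · intro hr; exact absurd (Finset.mem_univ r) hr
        have e2 : ∑ r, M r k * M⁻¹ ℓ r = (M⁻¹ * M) ℓ k := by
          rw [Matrix.mul_apply]; exact Finset.sum_congr rfl fun r _ => mul_comm _ _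
        rw [Finset.sum_congr rfl fun r _ => e1 r, e2, hMinvM, Matrix.one_apply, hdual]
        by_cases hkl : k = ℓ
        · rw [if_pos hkl, if_pos hkl.symm]
        · rw [if_neg hkl, if_neg (Ne.symm hkl)]
      · have e1 : ∀ r : Fin n₀, ∑ s, (Gm 1 r k * Gm 0 s ℓ) • ψC (cb (1, r)) (cb (0, s)) = -(M⁻¹ k r * M r ℓ) := by
          intro r
          rw [Finset.sum_eq_single r]
          · rw [hswap10, if_pos rfl, smul_neg, smul_eq_mul, mul_one, hGm0, hGm1, Matrix.transpose_apply]
          · intro s _ hs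
            rw [hswap10, if_neg hs, neg_zero, smul_zero]
          · intro hr; exact absurd (Finset.mem_univ r) hr
        have e2 : ∑ r, -(M⁻¹ k r * M r ℓ) = -(M⁻¹ * M) k ℓ := by
          rw [Finset.sum_neg_distrib, Matrix.mul_apply]
        rw [Finset.sum_congr rfl fun r _ => e1 r, e2, hMinvM, Matrix.one_apply, hswap10]
        by_cases hkl : k = ℓ
        · rw [if_pos hkl, if_pos hkl.symm]
        · rw [if_neg hkl, if_neg (Ne.symm hkl)]
      · simp only [hiso1, smul_zero, Finset.sum_const_zero]
    intro x y
    have e := LinearMap.congr_fun (LinearMap.congr_fun hB x) y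
    rw [LinearMap.compl₁₂_apply, LinearEquiv.coe_coe] at e
    exact e
  -- `det(v₀|_W_K) = det M = 1`
  have hv₀det : LinearMap.det ((v₀ : Module.End ℂ (ℂ ⊗[ℚ] bettiCohomology A.X 1)).restrict
      fun x (hx : x ∈ Module.End.eigenspace (φQ.baseChange ℂ) μK) =>
        UnitaryTheta.apply_mem_eigenspace_of_commute hv₀φ hx) = 1 := by
    rw [det_restrict_eq_of_apply_eq_sum bW hbW _ M (fun ℓ => by rw [LinearEquiv.coe_coe, hv₀cb, hGm0]), hdetM]
  -- on `W_K`, `v₀` is `u`: `ρ (v₀ x) = u (ρ x)`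
  have hρv₀cb : ∀ ℓ, ρ (v₀ (cb (0, ℓ))) = u (ρ (cb (0, ℓ))) := fun ℓ => by
    rw [hv₀cb, hGm0, map_sum, ← hxb_apply, hMu]
    exact Finset.sum_congr rfl fun r _ => by rw [map_smul, hxb_apply]
  have hρv₀ : ∀ x ∈ Module.End.eigenspace (φQ.baseChange ℂ) μK, ρ (v₀ x) = u (ρ x) := by
    intro x hx
    rw [hWexp x hx]
    simp only [map_sum, map_smul, hρv₀cb]
  -- `v₀` commutes with every Hodge endomorphism on `W_K` …
  have hv₀θW : ∀ (θ : A ⟶ A), ∀ x ∈ Module.End.eigenspace (φQ.baseChange ℂ) μK,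
      v₀ (((bettiCohomology.map θ.hom.hom.hom 1).hom).baseChange ℂ x) =
        ((bettiCohomology.map θ.hom.hom.hom 1).hom).baseChange ℂ (v₀ x) := by
    intro θ x hx
    apply ρ.injective
    rw [hρv₀ _ (hθW θ μK x hx), hρθ, huθ, ← hρv₀ x hx, ← hρθ]
  have hv₀ηW : ∀ η ∈ (BettiUniverse.hodge hHD (AbelianVariety.isSmoothProjective_holds (A := A)) 1).endAlg,
      ∀ x ∈ Module.End.eigenspace (φQ.baseChange ℂ) μK, v₀ (η.baseChange ℂ x) = η.baseChange ℂ (v₀ x) := by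
    intro η hη x hx
    obtain ⟨c, F, rfl⟩ := exists_eq_smul_bettiMapHom_of_mem_endAlg hη
    rw [LinearMap.baseChange_smul, LinearMap.smul_apply, LinearMap.smul_apply, ← ratCast_smul₇, ← ratCast_smul₇,
      LinearEquiv.map_smul, hv₀θW F x hx]
  -- … and on `W̄_K` (adjoint trick + dual expansion), hence everywhere
  have hv₀symmφ : ∀ z, v₀.symm (φQ.baseChange ℂ z) = φQ.baseChange ℂ (v₀.symm z) := fun z => by
    apply v₀.injective
    have h := LinearMap.congr_fun hv₀φ (v₀.symm z)
    simp only [Module.End.mul_apply, LinearEquiv.coe_coe, LinearEquiv.apply_symm_apply] at h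
    rw [LinearEquiv.apply_symm_apply, h]
  have hv₀symmW : ∀ x ∈ Module.End.eigenspace (φQ.baseChange ℂ) μK,
      v₀.symm x ∈ Module.End.eigenspace (φQ.baseChange ℂ) μK := by
    intro x hx
    rw [Module.End.mem_eigenspace_iff] at hx ⊢
    rw [← hv₀symmφ, hx, LinearEquiv.map_smul]
  have hv₀comm1 : ∀ (θ : A ⟶ A) ℓ, v₀ (((bettiCohomology.map θ.hom.hom.hom 1).hom).baseChange ℂ (cb (1, ℓ))) =
      ((bettiCohomology.map θ.hom.hom.hom 1).hom).baseChange ℂ (v₀ (cb (1, ℓ))) := by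
    intro θ ℓ
    set θQ := ((bettiCohomology.map θ.hom.hom.hom 1).hom).baseChange ℂ with hθQ
    have hθE := pullback_mem_endAlg hHD hI θ
    have hadjE := ψ.adjoint_mem_endAlg hθE
    have hL : v₀ (θQ (cb (1, ℓ))) ∈ Module.End.eigenspace (φQ.baseChange ℂ) (-μK) :=
      hv₀W' _ (hθW θ _ _ (hKcb' ℓ))
    have hR : θQ (v₀ (cb (1, ℓ))) ∈ Module.End.eigenspace (φQ.baseChange ℂ) (-μK) :=
      hθW θ _ _ (hv₀W' _ (hKcb' ℓ))
    rw [eq_sum_form_smul_of_mem_eigenspace cb hμKne hKcb hKcb' ψC hdual hL,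
      eq_sum_form_smul_of_mem_eigenspace cb hμKne hKcb hKcb' ψC hdual hR]
    refine Finset.sum_congr rfl fun i _ => ?_
    -- `ψ(e_i, v₀ θ y) = ψ(v₀⁻¹ e_i, θ y) = ψ(θ† v₀⁻¹ e_i, y) = ψ(v₀ θ† v₀⁻¹ e_i, v₀ y) = ψ(θ† e_i, v₀ y) = ψ(e_i, θ v₀ y)`
    have hw : v₀.symm (cb (0, i)) ∈ Module.End.eigenspace (φQ.baseChange ℂ) μK := hv₀symmW _ (hKcb i)
    have hw_eq : v₀ (v₀.symm (cb (0, i))) = cb (0, i) := v₀.apply_symm_apply _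
    generalize v₀.symm (cb (0, i)) = w at hw hw_eq
    have e1 : ψC (cb (0, i)) (v₀ (θQ (cb (1, ℓ)))) = ψC w (θQ (cb (1, ℓ))) := by rw [← hw_eq, hv₀ψ]
    have e2 : ψC w (θQ (cb (1, ℓ))) =
        ψC ((ψ.adjoint (bettiCohomology.map θ.hom.hom.hom 1).hom).baseChange ℂ w) (cb (1, ℓ)) := by
      rw [hψC, hθQ, ψ.form_baseChange_adjoint_left]
    have e34 : ψC ((ψ.adjoint (bettiCohomology.map θ.hom.hom.hom 1).hom).baseChange ℂ w) (cb (1, ℓ)) =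
        ψC ((ψ.adjoint (bettiCohomology.map θ.hom.hom.hom 1).hom).baseChange ℂ (cb (0, i))) (v₀ (cb (1, ℓ))) := by
      rw [← hv₀ψ ((ψ.adjoint (bettiCohomology.map θ.hom.hom.hom 1).hom).baseChange ℂ w) (cb (1, ℓ)),
        hv₀ηW _ hadjE w hw, hw_eq]
    have e5 : ψC ((ψ.adjoint (bettiCohomology.map θ.hom.hom.hom 1).hom).baseChange ℂ (cb (0, i))) (v₀ (cb (1, ℓ))) =
        ψC (cb (0, i)) (θQ (v₀ (cb (1, ℓ)))) := by
      rw [hψC, hθQ, ψ.form_baseChange_adjoint_left]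
    rw [e1, e2, e34, e5]
  have hv₀all : ∀ θ : A ⟶ A, (v₀ : Module.End ℂ (ℂ ⊗[ℚ] bettiCohomology A.X 1)) *
      ((bettiCohomology.map θ.hom.hom.hom 1).hom).baseChange ℂ =
      ((bettiCohomology.map θ.hom.hom.hom 1).hom).baseChange ℂ * (v₀ : Module.End ℂ (ℂ ⊗[ℚ] bettiCohomology A.X 1)) := by
    intro θ
    refine cb.ext fun tl => ?_
    obtain ⟨t, ℓ⟩ := tl
    rw [Module.End.mul_apply, Module.End.mul_apply, LinearEquiv.coe_coe]
    rcases fin2_cases₇ t with rfl | rfl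
    · exact hv₀θW θ _ (hKcb ℓ)
    · exact hv₀comm1 θ ℓ
  -- the transport `v` of `v₀` to `H¹(A(ℂ); ℂ)`; `v ∈ C(A)^×`
  set v : complexBetti A.X 1 ≃ₗ[ℂ] complexBetti A.X 1 := ρ.symm.trans (v₀.trans ρ) with hvdef
  have hv_apply : ∀ z, v z = ρ (v₀ (ρ.symm z)) := fun z => rfl
  set x : Fin 2 × Fin n₀ → complexBetti A.X 1 := fun tl => ofRatClassBaseChange (Motives.ComplexPoints A.X) 1 (cb tl)
    with hxdef
  have hxρ : ∀ tl, x tl = ρ (cb tl) := fun tl => by rw [hxdef, hρ, ofRatClassBaseChangeEquiv_apply]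
  have hvx : ∀ t ℓ, v (x (t, ℓ)) = ∑ r, Gm t r ℓ • x (t, r) := fun t ℓ => by
    rw [hxρ, hv_apply, ρ.symm_apply_apply, hv₀cb, map_sum]
    exact Finset.sum_congr rfl fun r _ => by rw [map_smul, hxρ]
  have hvC : v ∈ centralizerGroup A := by
    rw [mem_centralizerGroup_iff]
    intro θ z
    rw [hv_apply, hv_apply]
    have h1 : ρ.symm (pullbackOne A θ z) = ((bettiCohomology.map θ.hom.hom.hom 1).hom).baseChange ℂ (ρ.symm z) := by
      apply ρ.injective
      rw [ρ.apply_symm_apply, hρθ, LinearEquiv.apply_symm_apply]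
    have h2 := LinearMap.congr_fun (hv₀all θ) (ρ.symm z)
    simp only [Module.End.mul_apply, LinearEquiv.coe_coe] at h2
    rw [h1, h2, hρθ]
  -- `⋀•(v^{⊕(a+1)})` fixes every rational `(p,p)`-class of every power (§1 + S1-T)
  have key : ∀ (a p : ℕ) (c : complexBetti (A.powSucc a).X (2 * p)), IsRationalClass c →
      IsOfHodgeType (A.powSucc a).dim (A.powSucc a).X (2 * p) p p c → diagPowExterior A v a (2 * p) c = c := by
    intro a p c hcQ hc
    rcases Nat.eq_zero_or_pos p with rfl | hp
    · obtain ⟨t, rfl⟩ := exists_eq_smul_one_of_isSmoothProjective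
        (AbelianVariety.isSmoothProjective_holds (A := A.powSucc a)) ℂ c
      rw [map_smul]
      congr 1
      show diagPowExterior A v a 0 _ = _
      rw [diagPowExterior, exteriorPullbackEquiv_apply, exteriorPullback_one]
    · obtain ⟨cf, hcf, hkill⟩ := (AVSlots.powSucc A a).exists_tiedBlockSlInvariant_coeff_of_hodgeLieC ψ φ hZ hμKne hSU cb
        κ blk T hT1 hKcb hKcb' hcb0 hcb1 hdual hiso hEU hET hp hcQ hc
      rw [← hcf, diagPowExterior_wordEval_avLetters_eq_wordEval_colourChangeAt hvC x Gm hvx a (2 * p) cf,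
        colourChangeAt_eq_self_of_forall_wordSlice]
      intro U
      set ty : Fin (2 * p) → Bool := fun q => decide ((U q).2 = 0) with hty
      have hfamG : (fun q => Gm (U q).2) = mixedGrpFamily ty M := by
        funext q
        by_cases hq : (U q).2 = 0
        · rw [hq, mixedGrpFamily_of_eq_true M (by simp [hty, hq])]
          exact if_pos rfl
        · have hq1 : (U q).2 = 1 := (fin2_cases₇ _).resolve_left hq
          rw [hq1, mixedGrpFamily_of_eq_false M (by simp [hty, hq1])]
          exact if_neg one_ne_zero
      rw [hfamG]
      refine wordRepAt_mixedGrpFamily_eq_self_of_forall_tiedBlockDiag_trace_of_det_eq_one blk T hT1 hi₀ ty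
        (fun X hXb hXtr hXT => ?_) hMb hMT hdetM
      have hfam : mixedLieFamily ty X = fun t => if (U t).2 = 0 then X else -Xᵀ := by
        funext t
        simp only [mixedLieFamily, hty, decide_eq_true_eq]
      rw [hfam]
      exact hkill U X hXb hXtr hXT
  have hmem := exteriorPullbackEquiv_mem_hodgeGroup_of_forall key
  have hvHg : v ∈ hodgeGroupOne A.dim A.X := mem_hodgeGroupOne_iff.2 ⟨_, hmem, exteriorPullbackEquiv_one_eq _ v⟩
  -- `u = v` (S3 §3): they agree on the letters of `W_K` …
  have hvS : v ∈ unitaryCentralizerGroup A h := hodgeGroupOne_le_unitaryCentralizerGroup hh hvHg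
  have hvxb : ∀ t ℓ, v (xb (t, ℓ)) = ∑ r, Gm t r ℓ • xb (t, r) := fun t ℓ => by
    rw [hxb_apply, hv_apply, ρ.symm_apply_apply, hv₀cb, map_sum]
    exact Finset.sum_congr rfl fun r _ => by rw [map_smul, hxb_apply]
  have huv0 : ∀ ℓ, u (xb (0, ℓ)) = v (xb (0, ℓ)) := fun ℓ => by rw [hMu, hvxb, hGm0]
  -- … `W̄_K` is `Q_h`-isotropic …
  have hisoQ : ∀ y ∈ Module.End.eigenspace (pullbackOne A φ) (-μK), ∀ y' ∈ Module.End.eigenspace (pullbackOne A φ) (-μK),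
      Q y y' = 0 := by
    intro y hy y' hy'
    rw [Module.End.mem_eigenspace_iff] at hy hy'
    have h1 := hφQ y y'
    rw [hy, hy', map_smul, LinearMap.map_smul₂, smul_smul, neg_mul_neg, hμK2] at h1
    have h2 : ((2 : ℂ) * (d : ℂ)) • Q y y' = 0 := by
      rw [mul_smul, two_smul]
      nth_rw 1 [← h1]
      rw [neg_smul, neg_add_cancel]
    rcases smul_eq_zero.1 h2 with h3 | h3
    · exfalso
      exact mul_ne_zero two_ne_zero (Nat.cast_ne_zero.2 hW.d_pos.ne') h3
    · exact h3
  have hxbW' : ∀ ℓ, xb (1, ℓ) ∈ Module.End.eigenspace (pullbackOne A φ) (-μK) := fun ℓ =>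
    Module.End.mem_eigenspace_iff.2 (by rw [hφxb, if_neg one_ne_zero])
  have hvφ : ∀ z, v (pullbackOne A φ z) = pullbackOne A φ (v z) := fun z => (mem_centralizerGroup_iff.1 hvS.1) φ z
  -- … so they agree on the letters of `W̄_K` (`Q_h` non-degenerate)
  have huv1 : ∀ ℓ, u (xb (1, ℓ)) = v (xb (1, ℓ)) := by
    intro ℓ
    rw [← sub_eq_zero]
    apply hnd
    suffices hcomp : Q (u (xb (1, ℓ)) - v (xb (1, ℓ))) ∘ₗ (u : complexBetti A.X 1 →ₗ[ℂ] complexBetti A.X 1) = 0 by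
      intro y
      obtain ⟨z, rfl⟩ := u.surjective y
      have e := LinearMap.congr_fun hcomp z
      rwa [LinearMap.comp_apply, LinearEquiv.coe_coe, LinearMap.zero_apply] at e
    refine xb.ext fun tk => ?_
    obtain ⟨t, k⟩ := tk
    rw [LinearMap.comp_apply, LinearEquiv.coe_coe, LinearMap.zero_apply, map_sub, LinearMap.sub_apply]
    rcases fin2_cases₇ t with rfl | rfl
    · rw [hu.2, huv0, hvS.2, sub_self]
    · have hmem' : ∀ w : complexBetti A.X 1 ≃ₗ[ℂ] complexBetti A.X 1, (∀ z, w (pullbackOne A φ z) = pullbackOne A φ (w z)) →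
          ∀ ℓ', w (xb (1, ℓ')) ∈ Module.End.eigenspace (pullbackOne A φ) (-μK) :=
        fun w hw ℓ' => VanGeemen1994.mapsTo_eigenspace_of_comm hw (-μK) (hxbW' ℓ')
      rw [hisoQ _ (hmem' u (huθ φ) ℓ) _ (hmem' u (huθ φ) k), hisoQ _ (hmem' v hvφ ℓ) _ (hmem' u (huθ φ) k), sub_self]
  have huv : u = v := by
    refine LinearEquiv.ext fun z => ?_
    have e : (u : complexBetti A.X 1 →ₗ[ℂ] complexBetti A.X 1) = (v : complexBetti A.X 1 →ₗ[ℂ] complexBetti A.X 1) := by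
      refine xb.ext fun tk => ?_
      obtain ⟨t, k⟩ := tk
      rcases fin2_cases₇ t with rfl | rfl
      · exact huv0 k
      · exact huv1 k
    exact LinearMap.congr_fun e z
  rw [huv]
  exact hvHg

end SocketT

end Literature.AlgebraicGeometry.HodgeTheory

end
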